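import Literature.Analysis.FunctionSpaces.TorusShearKoopman
import Mathlib.Analysis.Normed.Lp.lpSpace
import Mathlib.Analysis.Normed.Group.Tannery
import HarnessLib

/-!
# The inviscid shear cascade: a lacunary alternating cascade of transversal shears whose states
# split into a strongly convergent low part and an escaping front

Analysis/FluidPDE file (all proved; no named facts) — the combinatorial–harmonic core of an
alternating-shear discharge of `Literature.Analysis.FluidPDE.cheskidov_time_periodic_anomaly`
(Cheskidov, arXiv:2311.04182, Thm. 1.3) that replaces the Alberti–Crippa–Mazzucato mixing flow of
the source's §3 by explicit shears. Everything here is inviscid and takes place on the Fourier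
side of `T²`; the drifts, the advection–diffusion solutions and the periodisation are the
business of the follow-up files `ShearCascadeDrifts`, `ShearCascadeFamily` (which produce a
`CheskidovPeriodic.PartialFamilyData`) and of the accepted `CheskidovPartialPeriodisation`.

## The construction

Fix profile data `PF : ShearCascade.ProfileFamily` (smooth `1`-periodic profiles `S_s`,
`|S_s| ≤ 1`, mean zero, with oscillatory means `|∫₀¹e^{-2πi a S_s}| ≤ 4|ε| + res s` at the
near-half-integer phases `a = l/2 + ε`, `res s ≤ 2^{-(s+4)}` — realised by the near-triangle waves of
`ShearCascadeProfiles`) and an arbitrary external constraint `extra : ℕ → (ℕ → ℕ) → ℕ` (the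
kinematic lower bounds the drift file wants for the frequencies; this file works for every
`extra`). Stage `s` displaces along the axis `dir s = s mod 2`, driven by the other coordinate,
with profile `D_s S_s(F_s ·)`, `D_s = 1/(2F_{s-1})` (`stageProfile`); the states are
`Θ_0 = ρ_in = √2 cos(2π x_{dir 1})` and `Θ_s = Θ_{s-1} ∘ Φ_s` (`ProfileFamily.Theta`, real, smooth,
`∫Θ_s² = 1`, `∫Θ_s = 0`). The frequencies are chosen **inductively**
(`ProfileFamily.F`, through the prefixes `pre` and `next`): `F_0 = 1` and `F_s` is the maximum of
`8F_{s-1}`, `extra s (prefix)` and `2^{s+6}(K_s + 1)`, where the tail threshold `K_s`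
(`Kseq`, `tailK`) is the least `K` with `‖P_{|k·u_{s+1}| ≥ K} 𝓕Θ_{s-1}‖² ≤ tol s = 4^{-(s+4)}`
(tails of a fixed `ℓ²` family tend to zero, `tendsto_tailSq`). Guarantees: `F_succ`,
`eight_mul_F_le`, `extra_le_F`, `pow_mul_Kseq_le`, `tailSq_Kseq_le`.

## The two key lemmas and the limit

With `cf m = 𝓕Θ_m ∈ ℓ²(ℤ²)` (`coef`, `band`: the `ℓ²` bookkeeping of §1), `Low m = {4|k_l| < F_m}`,
`Front m = {4|k·u_{m+1}| ≥ F_m}`, `β m = ‖P_{Front m} cf m‖²`: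

* `norm_band_Low_sub_le` (**the low modes freeze**): `‖P_{Low m}(cf(m+1) - cf m)‖ ≤ 3·2^{-(m+4)}`
  (`m ≥ 1`) — near-identity of the stage on `|k_i| < K_m` (factor `πK_m/F_m`,
  `TorusShearKoopman.integral_norm_sq_comp_shearMap_sub_le`), smallness of the *bad* band
  `K_m ≤ |k_i| < F_m/4` before and after the stage (`Nbad`, invariant under the `F_m`-shifts by
  which stage `m` moves `k_i`, `norm_band_Nbad_le`), invisibility of the front in `Low m`;
* `β_succ_ge` (**the front persists**): `β(m+1) ≥ β m - 9·4^{-(m+4)}` (`m ≥ 1`) — the scattered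
  part of the front lands at `|k_j| ≥ F_{m+1} - K_{m+1} ≥ F_{m+1}/4` (lacunarity: the spread is
  only upward), the unscattered part reads the multipliers `ĝ_n(0) = ∫₀¹e^{-2πi nD S}` at phases
  `nD = l/2 + q/(2F_m)`, `l ≠ 0`, of size `≤ 2^{-(m+4)}` (`norm_multiplier_front_le`, from the
  residue field of `ProfileFamily`); with `β_one_ge` (`β 1 ≥ 1 - 4^{-5}`) this telescopes to
  `β m ≥ 63/64`, whence `‖P_{Low m} cf m‖ ≤ 1/8` (`norm_band_Low_le`);
* the **strong low-frequency limit** `R ∈ ℓ²` (`ProfileFamily.R`): level limits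
  `R_m = lim_n P_{Low m} cf(m+n)` (geometric Cauchy bound), consistency `P_{Low m}R_{m'} = R_m`,
  Pythagoras between levels, `R = lim R_m`; `‖P_{Low m} cf m - R‖ → 0`
  (`tendsto_norm_band_Low_sub_R`) and `‖R‖ ≤ 1/8` (`norm_R_le`), so at least `63/64` of the unit
  variance escapes to infinite frequency while the rest converges strongly — exactly the
  dichotomy a *partial*-dissipation family needs; `R` is Hermitian and is realised by the real
  `L²` function `Rfn` (`mFourierCoeff_Rfn`, Riesz–Fischer through Mathlib's `mFourierBasis`).

## Mathlib / tree search

Mathlib: `lp`/`Memℓp` (`ℓ²` bookkeeping), `UnitAddTorus.mFourierBasis(_repr)`,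
`tendsto_tsum_of_dominated_convergence` (Tannery), `cauchySeq_of_le_geometric`,
`dist_le_of_le_geometric_of_tendsto₀`, `tendsto_atTop_ciSup`. Tree: `TorusShearKoopman`
(shear maps, fibre formula and its consequences, spectral pieces, near-identity estimate),
`Torus.hasSum_sq_mFourierCoeff_of_continuous`, `Torus.mFourierCoeff_mFourier`,
`Torus.volume_unitAddCircle_eq_haar`.

## References

* A. Cheskidov, arXiv:2311.04182 (2023), §§3–4, §6 (the role this core plays: a family whose
  scalars are mixed to frequencies `≳ F_m` up to a strongly convergent remainder).
* R. T. Pierrehumbert, Chaos Solitons Fractals 4 (1994) 1091–1110; T. M. Elgindi, A. Zlatoš,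
  *Universal mixers in all dimensions*, Adv. Math. 356 (2019) (alternating shears as mixers) —
  context only; the lacunary bookkeeping here is self-contained.
-/

open MeasureTheory Set Filter Topology Function UnitAddTorus
open scoped ENNReal NNReal ContDiff ComplexConjugate
open Literature.Analysis.FunctionSpaces.Torus

noncomputable section

namespace Literature.Analysis.FluidPDE

namespace ShearCascade

/-- The flat two-torus (local notation). [folklore] -/
local notation "𝕋²" => UnitAddTorus (Fin 2)

/-! ## `ℓ²` bookkeeping on the frequency lattice -/

/-- The frequency lattice of `T²`. [folklore] -/
abbrev Mode := Fin 2 → ℤ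

/-- Square-summable families on the frequency lattice. [folklore] -/
abbrev El2 := lp (fun _ : Mode => ℂ) 2

section El2

/-- `‖f‖² = ∑ ‖f k‖²` in `ℓ²`. [folklore] -/
theorem hasSum_norm_sq (f : El2) : HasSum (fun k => ‖f k‖ ^ 2) (‖f‖ ^ 2) := by
  have h := lp.hasSum_norm (p := (2 : ℝ≥0∞)) (by norm_num) f
  simp only [ENNReal.toReal_ofNat, Real.rpow_two] at h
  exact h

/-- `‖f‖² = ∑' ‖f k‖²`. [folklore] -/
theorem norm_sq_eq_tsum (f : El2) : ‖f‖ ^ 2 = ∑' k, ‖f k‖ ^ 2 :=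
  (hasSum_norm_sq f).tsum_eq.symm

/-- Squares of the entries of an `ℓ²` family are summable. [folklore] -/
theorem summable_norm_sq (f : El2) : Summable fun k => ‖f k‖ ^ 2 :=
  (hasSum_norm_sq f).summable

/-- **Band projection**: restriction of an `ℓ²` family to a set of modes. [folklore] -/
def band (A : Set Mode) (f : El2) : El2 :=
  ⟨fun k => A.indicator (⇑f) k, (memℓp_norm_iff.2 (lp.memℓp f)).mono fun _ => norm_indicator_le_norm_self _ _⟩

/-- Entries of a band projection. [folklore] -/
@[simp]
theorem band_apply (A : Set Mode) (f : El2) (k : Mode) : band A f k = A.indicator (⇑f) k := rfl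

/-- Band projections are additive. [folklore] -/
theorem band_add (A : Set Mode) (f g : El2) : band A (f + g) = band A f + band A g := by
  apply lp.ext; funext k
  by_cases hk : k ∈ A <;> simp [hk]

/-- Band projections commute with subtraction. [folklore] -/
theorem band_sub (A : Set Mode) (f g : El2) : band A (f - g) = band A f - band A g := by
  apply lp.ext; funext k
  by_cases hk : k ∈ A <;> simp [hk]

/-- Band projection of `0`. [folklore] -/
@[simp]
theorem band_zero (A : Set Mode) : band A (0 : El2) = 0 := by
  apply lp.ext; funext; simp

/-- Iterated band projections. [folklore] -/
theorem band_band (A B : Set Mode) (f : El2) : band A (band B f) = band (A ∩ B) f := by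
  apply lp.ext; funext k
  by_cases hA : k ∈ A <;> by_cases hB : k ∈ B <;> simp [hA, hB]

/-- `‖P_A f‖² = ∑_{k ∈ A} ‖f k‖²`. [folklore] -/
theorem hasSum_norm_sq_band (A : Set Mode) (f : El2) :
    HasSum (fun k => A.indicator (fun k => ‖f k‖ ^ 2) k) (‖band A f‖ ^ 2) := by
  have h := hasSum_norm_sq (band A f)
  refine h.congr_fun fun k => ?_
  simp only [band_apply]
  by_cases hk : k ∈ A <;> simp [hk]

/-- **Pythagoras for a band and its complement**: `‖P_A f‖² + ‖P_{Aᶜ} f‖² = ‖f‖²`. [folklore] -/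
theorem norm_sq_band_add_compl (A : Set Mode) (f : El2) : ‖band A f‖ ^ 2 + ‖band Aᶜ f‖ ^ 2 = ‖f‖ ^ 2 := by
  have h := (hasSum_norm_sq_band A f).add (hasSum_norm_sq_band Aᶜ f)
  have h' : HasSum (fun k => ‖f k‖ ^ 2) (‖band A f‖ ^ 2 + ‖band Aᶜ f‖ ^ 2) :=
    h.congr_fun fun k => (Set.indicator_self_add_compl_apply A (fun k => ‖f k‖ ^ 2) k).symm
  exact h'.unique (hasSum_norm_sq f)

/-- `‖P_A f‖ ≤ ‖f‖`. [folklore] -/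
theorem norm_band_le (A : Set Mode) (f : El2) : ‖band A f‖ ≤ ‖f‖ := by
  have h := norm_sq_band_add_compl A f
  nlinarith [norm_nonneg (band A f), norm_nonneg (band Aᶜ f), norm_nonneg f, sq_nonneg ‖band Aᶜ f‖]

/-- Monotonicity of band norms in the band. [folklore] -/
theorem norm_band_mono {A B : Set Mode} (hAB : A ⊆ B) (f : El2) : ‖band A f‖ ≤ ‖band B f‖ := by
  have : band A f = band A (band B f) := by rw [band_band, Set.inter_eq_left.2 hAB]
  rw [this]; exact norm_band_le _ _

/-- A family supported in `A` is its own `A`-band. [folklore] -/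
theorem band_eq_self {A : Set Mode} {f : El2} (h : ∀ k ∉ A, f k = 0) : band A f = f := by
  apply lp.ext; funext k
  by_cases hk : k ∈ A
  · simp [hk]
  · simp [hk, h k hk]

/-- A family vanishing on `A` has zero `A`-band. [folklore] -/
theorem band_eq_zero {A : Set Mode} {f : El2} (h : ∀ k ∈ A, f k = 0) : band A f = 0 := by
  apply lp.ext; funext k
  by_cases hk : k ∈ A
  · simp [hk, h k hk]
  · simp [hk]

/-- **Pythagoras for disjointly supported families.** [folklore] -/
theorem norm_sq_add_of_disjoint {f g : El2} (h : ∀ k, f k = 0 ∨ g k = 0) : ‖f + g‖ ^ 2 = ‖f‖ ^ 2 + ‖g‖ ^ 2 := by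
  have hf := hasSum_norm_sq f
  have hg := hasSum_norm_sq g
  have hfg := hasSum_norm_sq (f + g)
  have key : HasSum (fun k => ‖(f + g) k‖ ^ 2) (‖f‖ ^ 2 + ‖g‖ ^ 2) := by
    refine (hf.add hg).congr_fun fun k => ?_
    rcases h k with hk | hk <;> simp [hk]
  exact hfg.unique key

/-- A pointwise comparison on a band transfers to band norms. [folklore] -/
theorem norm_band_le_of_pointwise {A : Set Mode} {f g : El2} {c : ℝ} (hc : 0 ≤ c)
    (h : ∀ k ∈ A, ‖f k‖ ≤ c * ‖g k‖) : ‖band A f‖ ≤ c * ‖band A g‖ := by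
  have h1 := hasSum_norm_sq_band A f
  have h2 := (hasSum_norm_sq_band A g).mul_left (c ^ 2)
  have hle : ‖band A f‖ ^ 2 ≤ c ^ 2 * ‖band A g‖ ^ 2 := by
    refine hasSum_le (fun k => ?_) h1 h2
    by_cases hk : k ∈ A
    · simp only [Set.indicator_of_mem hk]
      have := h k hk
      calc ‖f k‖ ^ 2 ≤ (c * ‖g k‖) ^ 2 := pow_le_pow_left₀ (norm_nonneg _) this 2
        _ = c ^ 2 * ‖g k‖ ^ 2 := by ring
    · simp [hk]
  have := Real.sqrt_le_sqrt hle
  rwa [Real.sqrt_sq (norm_nonneg _), Real.sqrt_mul' _ (sq_nonneg _), Real.sqrt_sq hc,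
    Real.sqrt_sq (norm_nonneg _)] at this

/-- The entries are bounded by the norm. [folklore] -/
theorem norm_apply_le_norm (f : El2) (k : Mode) : ‖f k‖ ≤ ‖f‖ :=
  lp.norm_apply_le_norm (by norm_num) f k

end El2

/-! ## Fourier coefficients of continuous functions as `ℓ²` families -/

section Coef

variable {θ φ : 𝕋² → ℂ}

/-- The Fourier coefficients of `θ : T² → ℂ` as an `ℓ²` family (junk `0` unless square
summable; for continuous `θ` this is the family `𝓕θ`, `coef_apply`). [folklore] -/
def coef (θ : 𝕋² → ℂ) : El2 :=
  haveI := Classical.propDecidable (Summable fun k => ‖mFourierCoeff θ k‖ ^ 2)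
  if h : Summable fun k => ‖mFourierCoeff θ k‖ ^ 2 then
    ⟨mFourierCoeff θ, memℓp_gen (by simpa using h)⟩
  else 0

/-- For continuous `θ` the squares of the coefficients are summable (Parseval). [folklore] -/
theorem summable_norm_sq_mFourierCoeff (hθ : Continuous θ) : Summable fun k => ‖mFourierCoeff θ k‖ ^ 2 :=
  (hasSum_sq_mFourierCoeff_of_continuous hθ).summable

/-- Entries of `coef θ` for continuous `θ`. [folklore] -/
@[simp]
theorem coef_apply (hθ : Continuous θ) (k : Mode) : coef θ k = mFourierCoeff θ k := by
  rw [coef, dif_pos (summable_norm_sq_mFourierCoeff hθ)]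

/-- **Parseval**: `‖coef θ‖² = ∫ ‖θ‖²` for continuous `θ`. [folklore] -/
theorem norm_coef_sq (hθ : Continuous θ) : ‖coef θ‖ ^ 2 = ∫ x, ‖θ x‖ ^ 2 := by
  have h := hasSum_norm_sq (coef θ)
  simp only [coef_apply hθ] at h
  exact h.unique (hasSum_sq_mFourierCoeff_of_continuous hθ)

/-- `coef (θ + φ) = coef θ + coef φ` for continuous functions. [folklore] -/
theorem coef_add (hθ : Continuous θ) (hφ : Continuous φ) : coef (θ + φ) = coef θ + coef φ := by
  apply lp.ext; funext k
  rw [lp.coeFn_add, Pi.add_apply, coef_apply (hθ.add hφ), coef_apply hθ, coef_apply hφ]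
  have h := mFourierCoeff_sub (hθ.add hφ).integrable_unitAddTorus hφ.integrable_unitAddTorus k
  rw [add_sub_cancel_right] at h
  rw [eq_sub_iff_add_eq] at h
  exact h.symm

/-- `coef (θ - φ) = coef θ - coef φ` for continuous functions. [folklore] -/
theorem coef_sub (hθ : Continuous θ) (hφ : Continuous φ) : coef (θ - φ) = coef θ - coef φ := by
  apply lp.ext; funext k
  rw [lp.coeFn_sub, Pi.sub_apply, coef_apply (hθ.sub hφ), coef_apply hθ, coef_apply hφ]
  exact mFourierCoeff_sub hθ.integrable_unitAddTorus hφ.integrable_unitAddTorus k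

/-- **Band projections are spectral pieces**: `P_A (coef θ) = coef (θ_A)` for smooth `θ`. [folklore] -/
theorem band_coef (hθ : IsSmooth θ) (A : Set Mode) : band A (coef θ) = coef (modePiece A θ) := by
  apply lp.ext; funext k
  rw [band_apply, coef_apply (isSmooth_modePiece hθ A).continuous, mFourierCoeff_modePiece hθ]
  congr 1
  funext k'
  exact coef_apply hθ.continuous k'

end Coef

/-! ## Directions, parameters and the profile data -/

section Setup

/-- The displacement direction of stage `s`: the stages alternate between the two axes
(`dir s = s mod 2`). [folklore] -/
def dir (s : ℕ) : Fin 2 := if s % 2 = 0 then 0 else 1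

/-- Consecutive stages displace along different axes. [folklore] -/
theorem dir_succ_ne (s : ℕ) : dir (s + 1) ≠ dir s := by
  unfold dir
  rcases Nat.mod_two_eq_zero_or_one s with h | h
  · have h1 : (s + 1) % 2 = 1 := by omega
    simp [h, h1]
  · have h1 : (s + 1) % 2 = 0 := by omega
    simp [h, h1]

/-- The direction pattern has period two. [folklore] -/
theorem dir_add_two (s : ℕ) : dir (s + 2) = dir s := by
  unfold dir
  have : (s + 2) % 2 = s % 2 := by omega
  rw [this]

/-- The two directions of consecutive stages exhaust the axes. [folklore] -/
theorem eq_dir_or_eq_dir_succ (s : ℕ) (i : Fin 2) : i = dir s ∨ i = dir (s + 1) := by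
  have h := dir_succ_ne s
  fin_cases i <;>
  · revert h
    generalize dir s = a
    generalize dir (s + 1) = b
    fin_cases a <;> fin_cases b <;> simp

/-- **The profile data consumed by the inviscid cascade**: a sequence of smooth `1`-periodic
profiles bounded by `1`, of zero mean, whose oscillatory means at the near-half-integer phases
`l/2 + ε` (`l ≠ 0`, `|ε| ≤ 1/4`) are at most `4|ε| + res s` with `res s ≤ 2^{-(s+4)}` (realised
by the near-triangle waves of `ShearCascadeProfiles`). [folklore] -/
structure ProfileFamily where
  /-- the profiles -/
  prof : ℕ → ShearProfile
  /-- the residue parameters -/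
  res : ℕ → ℝ
  abs_le_one : ∀ s t, |prof s t| ≤ 1
  mean_zero : ∀ s, ∫ t in (0 : ℝ)..1, prof s t = 0
  res_nonneg : ∀ s, 0 ≤ res s
  res_le : ∀ s, res s ≤ 1 / 2 ^ (s + 4)
  oscMean_le : ∀ (s : ℕ) (l : ℤ), l ≠ 0 → ∀ ε : ℝ, |ε| ≤ 4⁻¹ →
    ‖∫ t in (0 : ℝ)..1, Complex.exp (-(2 * Real.pi * Complex.I * ((l : ℝ) / 2 + ε) * prof s t))‖ ≤ 4 * |ε| + res s

/-- **The datum** `ρ_in(x) = √2 cos(2π x_{u₁})`, a unit-norm mean-zero mode pair in the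
direction of the first displacement. [folklore] -/
def rhoIn (x : 𝕋²) : ℝ := Real.sqrt 2 * (mFourier (Pi.single (dir 1) 1) x).re

/-- The displacement amplitude of stage `s` for the frequency assignment `g`:
`D_s = 1/(2 F_{s-1})`. [folklore] -/
def disp (g : ℕ → ℕ) (s : ℕ) : ℝ := 1 / (2 * g (s - 1))

namespace ProfileFamily

variable (PF : ProfileFamily)

/-- The shear profile of stage `s`: `t ↦ D_s S_s(F_s t)`. [folklore] -/
def stageProfile (g : ℕ → ℕ) (s : ℕ) : ShearProfile := (PF.prof s).scale (disp g s) (g s)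

/-- **The inviscid cascade states** `Θ_s = Θ_{s-1} ∘ Φ_s` for a frequency assignment `g`
(`Φ_s` the shear along `dir s` driven by the coordinate `dir (s+1)` with profile
`D_s S_s(F_s ·)`), `Θ_0 = ρ_in`. [folklore] -/
def Theta (g : ℕ → ℕ) : ℕ → 𝕋² → ℝ
  | 0 => rhoIn
  | s + 1 => Theta g s ∘ shearMap (dir (s + 1)) (dir (s + 2)) (PF.stageProfile g (s + 1))

/-- The complexified cascade state. [folklore] -/
def ThetaC (g : ℕ → ℕ) (s : ℕ) (x : 𝕋²) : ℂ := (PF.Theta g s x : ℂ)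

/-- `Θ_s` only depends on the frequencies of the stages `≤ s`. [folklore] -/
theorem Theta_congr {g g' : ℕ → ℕ} {s : ℕ} (h : ∀ r ≤ s, g r = g' r) : PF.Theta g s = PF.Theta g' s := by
  induction s with
  | zero => rfl
  | succ s ih =>
    simp only [Theta]
    rw [ih fun r hr => h r (Nat.le_succ_of_le hr)]
    have hd : disp g (s + 1) = disp g' (s + 1) := by
      simp only [disp, Nat.add_sub_cancel, h s (Nat.le_succ s)]
    simp only [stageProfile, hd, h (s + 1) le_rfl]

/-- `ρ_in` is smooth. [folklore] -/
theorem _root_.Literature.Analysis.FluidPDE.ShearCascade.isSmooth_rhoIn : IsSmooth rhoIn := by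
  have h : IsSmooth (fun x : 𝕋² => (mFourier (Pi.single (dir 1) 1) x).re) :=
    IsSmooth.comp_clm Complex.reCLM (isSmooth_mFourier _)
  exact IsSmooth.smul (Real.sqrt 2) h

end ProfileFamily

end Setup

/-! ## The datum: coefficients, norm, mean -/

section Datum

/-- The mode of the datum. [folklore] -/
def k₀ : Mode := Pi.single (dir 1) 1

/-- `k₀ ≠ -k₀`. [folklore] -/
theorem k₀_ne_neg : k₀ ≠ -k₀ := by
  intro h
  have := congrFun h (dir 1)
  simp [k₀] at this

/-- `k₀ ≠ 0`. [folklore] -/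
theorem k₀_ne_zero : k₀ ≠ 0 := by
  intro h
  have := congrFun h (dir 1)
  simp [k₀] at this

/-- The complexified datum is `(√2/2)(e_{k₀} + e_{-k₀})`. [folklore] -/
theorem rhoIn_complex_eq :
    (fun x : 𝕋² => (rhoIn x : ℂ)) = ((Real.sqrt 2 / 2 : ℝ) : ℂ) • (⇑(mFourier k₀) + ⇑(mFourier (-k₀))) := by
  funext x
  simp only [rhoIn, Pi.smul_apply, Pi.add_apply, smul_eq_mul, Complex.ofReal_mul, Complex.re_eq_add_conj,
    mFourier_neg, k₀]
  push_cast
  ring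

/-- **The Fourier coefficients of the datum**: `√2/2` at `±k₀`, zero elsewhere. [folklore] -/
theorem mFourierCoeff_rhoIn (k : Mode) :
    mFourierCoeff (fun x : 𝕋² => (rhoIn x : ℂ)) k =
      if k = k₀ then ((Real.sqrt 2 / 2 : ℝ) : ℂ) else if k = -k₀ then ((Real.sqrt 2 / 2 : ℝ) : ℂ) else 0 := by
  classical
  rw [rhoIn_complex_eq, mFourierCoeff_const_smul]
  have hadd : mFourierCoeff (⇑(mFourier k₀) + ⇑(mFourier (-k₀)) : 𝕋² → ℂ) k =
      mFourierCoeff (⇑(mFourier k₀) : 𝕋² → ℂ) k + mFourierCoeff (⇑(mFourier (-k₀)) : 𝕋² → ℂ) k := by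
    have h := mFourierCoeff_sub (((mFourier k₀).continuous.add (mFourier (-k₀)).continuous).integrable_of_hasCompactSupport
      (HasCompactSupport.of_compactSpace _)) ((mFourier (-k₀)).continuous.integrable_of_hasCompactSupport
      (HasCompactSupport.of_compactSpace _)) k
    rw [add_sub_cancel_right] at h
    rw [eq_sub_iff_add_eq] at h
    exact h.symm
  rw [hadd, mFourierCoeff_mFourier, mFourierCoeff_mFourier, smul_eq_mul]
  have hne : ¬ -k₀ = k₀ := fun h => k₀_ne_neg h.symm
  by_cases h1 : k = k₀
  · subst h1
    simp [k₀_ne_neg]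
  · by_cases h2 : k = -k₀
    · simp [h2, hne]
    · simp [h1, h2]

/-- The complexified datum is continuous. [folklore] -/
theorem continuous_rhoIn_complex : Continuous fun x : 𝕋² => (rhoIn x : ℂ) :=
  Complex.continuous_ofReal.comp isSmooth_rhoIn.continuous

/-- **`‖ρ_in‖_{L²} = 1`.** [folklore] -/
theorem integral_rhoIn_sq : ∫ x, rhoIn x ^ 2 = 1 := by
  have hP := hasSum_sq_mFourierCoeff_of_continuous continuous_rhoIn_complex
  have hval : HasSum (fun k : Mode => ‖mFourierCoeff (fun x : 𝕋² => (rhoIn x : ℂ)) k‖ ^ 2) 1 := by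
    classical
    have h2 : (0 : ℝ) ≤ Real.sqrt 2 / 2 := by positivity
    have hsq : (Real.sqrt 2 / 2) ^ 2 = 2⁻¹ := by
      rw [div_pow, Real.sq_sqrt (by norm_num)]; norm_num
    have hnorm : ‖(((Real.sqrt 2 / 2 : ℝ)) : ℂ)‖ ^ 2 = 2⁻¹ := by
      rw [Complex.norm_real, Real.norm_eq_abs, abs_of_nonneg h2, hsq]
    have hne : ¬ -k₀ = k₀ := fun h => k₀_ne_neg h.symm
    have hf : (fun k : Mode => ‖mFourierCoeff (fun x : 𝕋² => (rhoIn x : ℂ)) k‖ ^ 2) =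
        fun k => (if k = k₀ then 2⁻¹ else 0) + (if k = -k₀ then 2⁻¹ else 0) := by
      funext k
      rw [mFourierCoeff_rhoIn]
      by_cases h1 : k = k₀
      · subst h1
        rw [if_pos rfl, if_pos rfl, if_neg k₀_ne_neg, hnorm, add_zero]
      · by_cases hk2 : k = -k₀
        · rw [if_neg h1, if_pos hk2, if_neg h1, if_pos hk2, hnorm, zero_add]
        · rw [if_neg h1, if_neg hk2, if_neg h1, if_neg hk2, norm_zero]; norm_num
    rw [hf, show (1 : ℝ) = 2⁻¹ + 2⁻¹ by norm_num]
    exact (hasSum_ite_eq k₀ (2⁻¹ : ℝ)).add (hasSum_ite_eq (-k₀) (2⁻¹ : ℝ))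
  have h := hP.unique hval
  have e : ∫ x, rhoIn x ^ 2 = ∫ x : 𝕋², ‖(rhoIn x : ℂ)‖ ^ 2 :=
    integral_congr_ae (Eventually.of_forall fun x => by simp [Complex.norm_real, sq_abs])
  rw [e]
  exact h

/-- **`ρ_in` has zero mean.** [folklore] -/
theorem integral_rhoIn : ∫ x, rhoIn x = 0 := by
  have h0 : mFourierCoeff (fun x : 𝕋² => (rhoIn x : ℂ)) 0 = 0 := by
    rw [mFourierCoeff_rhoIn, if_neg (Ne.symm k₀_ne_zero), if_neg]
    intro h
    exact k₀_ne_zero (neg_eq_zero.1 h.symm)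
  rw [mFourierCoeff_eq_integral_volume] at h0
  simp only [neg_zero, mFourier_zero, smul_eq_mul] at h0
  have h1 : ∫ x, (rhoIn x : ℂ) = 0 := by
    rw [← h0]
    refine integral_congr_ae (Eventually.of_forall fun x => ?_)
    simp
  have h2 := integral_re (continuous_rhoIn_complex.integrable_of_hasCompactSupport (μ := volume)
    (HasCompactSupport.of_compactSpace _))
  simp only [RCLike.re_to_complex, Complex.ofReal_re] at h2
  rw [h2, h1, Complex.zero_re]

end Datum

/-! ## The cascade states: smoothness, norm, the complexification -/

namespace ProfileFamily

variable (PF : ProfileFamily) (g : ℕ → ℕ)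

/-- `Θ_s` is smooth. [folklore] -/
theorem isSmooth_Theta (s : ℕ) : IsSmooth (PF.Theta g s) := by
  induction s with
  | zero => exact isSmooth_rhoIn
  | succ s ih => exact ih.comp_shearMap _ _ _

/-- `Θ_s^ℂ` is smooth. [folklore] -/
theorem isSmooth_ThetaC (s : ℕ) : IsSmooth (PF.ThetaC g s) :=
  IsSmooth.comp_clm Complex.ofRealCLM (PF.isSmooth_Theta g s)

/-- `Θ_s^ℂ` is continuous. [folklore] -/
theorem continuous_ThetaC (s : ℕ) : Continuous (PF.ThetaC g s) := (PF.isSmooth_ThetaC g s).continuous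

/-- The recursion for the complexified states. [folklore] -/
theorem ThetaC_succ (s : ℕ) :
    PF.ThetaC g (s + 1) = PF.ThetaC g s ∘ shearMap (dir (s + 1)) (dir (s + 2)) (PF.stageProfile g (s + 1)) := by
  funext x; rfl

/-- `ThetaC` at stage `0`. [folklore] -/
theorem ThetaC_zero : PF.ThetaC g 0 = fun x => (rhoIn x : ℂ) := rfl

/-- **The cascade preserves the `L²` norm**: `∫ Θ_s² = 1`. [folklore] -/
theorem integral_Theta_sq (s : ℕ) : ∫ x, PF.Theta g s x ^ 2 = 1 := by
  induction s with
  | zero => exact integral_rhoIn_sq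
  | succ s ih =>
    have h := integral_comp_shearMap (dir_succ_ne (s + 1)).symm (PF.stageProfile g (s + 1))
      fun x => PF.Theta g s x ^ 2
    simp only [Theta, Function.comp_apply]
    rw [show dir (s + 1 + 1) = dir (s + 2) from rfl] at h
    rw [h]
    exact ih

/-- `‖coef Θ_s^ℂ‖ = 1`. [folklore] -/
theorem norm_coef_ThetaC (s : ℕ) : ‖coef (PF.ThetaC g s)‖ = 1 := by
  have h := norm_coef_sq (PF.continuous_ThetaC g s)
  have h1 : ∫ x, ‖PF.ThetaC g s x‖ ^ 2 = ∫ x, PF.Theta g s x ^ 2 :=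
    integral_congr_ae (Eventually.of_forall fun x => by simp [ThetaC, Complex.norm_real, sq_abs])
  have h2 := PF.integral_Theta_sq g s
  have h3 : ‖coef (PF.ThetaC g s)‖ ^ 2 = 1 := by rw [h, h1]; exact h2
  have := norm_nonneg (coef (PF.ThetaC g s))
  nlinarith

/-- `Θ_s` has zero mean (the shears preserve volume). [folklore] -/
theorem integral_Theta (s : ℕ) : ∫ x, PF.Theta g s x = 0 := by
  induction s with
  | zero => exact integral_rhoIn
  | succ s ih =>
    have h := integral_comp_shearMap (dir_succ_ne (s + 1)).symm (PF.stageProfile g (s + 1)) (PF.Theta g s)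
    simp only [Theta, Function.comp_apply]
    rw [show dir (s + 1 + 1) = dir (s + 2) from rfl] at h
    rw [h]
    exact ih

end ProfileFamily

/-! ## Tails of coefficient families -/

section Tails

/-- The modes whose `i`-th frequency is at least `K` in absolute value. [folklore] -/
def tailSet (i : Fin 2) (K : ℕ) : Set Mode := {k | (K : ℤ) ≤ |k i|}

/-- Membership in a tail set. [folklore] -/
@[simp]
theorem mem_tailSet {i : Fin 2} {K : ℕ} {k : Mode} : k ∈ tailSet i K ↔ (K : ℤ) ≤ |k i| := Iff.rfl

/-- The squared `ℓ²` mass of a family on a tail set. [folklore] -/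
def tailSq (f : El2) (i : Fin 2) (K : ℕ) : ℝ := ‖band (tailSet i K) f‖ ^ 2

/-- **Tails of square-summable families tend to zero.** [folklore] -/
theorem tendsto_tailSq (f : El2) (i : Fin 2) : Tendsto (fun K => tailSq f i K) atTop (𝓝 0) := by
  have hsum := summable_norm_sq f
  have h : ∀ K, tailSq f i K = ∑' k, (tailSet i K).indicator (fun k => ‖f k‖ ^ 2) k := fun K =>
    ((hasSum_norm_sq_band (tailSet i K) f).tsum_eq).symm
  simp_rw [h]
  rw [show (0 : ℝ) = ∑' _ : Mode, (0 : ℝ) by simp]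
  refine tendsto_tsum_of_dominated_convergence hsum (fun k => ?_) (Eventually.of_forall fun K k => ?_)
  · -- eventually the mode `k` leaves the tail set
    refine tendsto_const_nhds.congr' ?_
    filter_upwards [eventually_gt_atTop (|k i|).toNat] with K hK
    rw [Set.indicator_of_notMem]
    rw [mem_tailSet, not_le]
    have : ((|k i|).toNat : ℤ) = |k i| := Int.toNat_of_nonneg (abs_nonneg _)
    omega
  · rw [Real.norm_eq_abs, abs_of_nonneg (Set.indicator_nonneg (fun _ _ => sq_nonneg _) _)]
    exact Set.indicator_le_self' (fun _ _ => sq_nonneg _) _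

/-- For every tolerance there is a tail threshold. [folklore] -/
theorem exists_tailSq_le (f : El2) (i : Fin 2) {ε : ℝ} (hε : 0 < ε) : ∃ K : ℕ, tailSq f i K ≤ ε := by
  obtain ⟨K, hK⟩ := (((tendsto_tailSq f i).eventually (Iic_mem_nhds hε))).exists
  exact ⟨K, hK⟩

/-- Tails are monotone in the threshold. [folklore] -/
theorem tailSq_anti (f : El2) (i : Fin 2) {K K' : ℕ} (h : K ≤ K') : tailSq f i K' ≤ tailSq f i K := by
  unfold tailSq
  have hsub : tailSet i K' ⊆ tailSet i K := fun k hk => by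
    rw [mem_tailSet] at hk ⊢; omega
  have := norm_band_mono hsub f
  exact pow_le_pow_left₀ (norm_nonneg _) this 2

end Tails

/-! ## The frequency recursion -/

section Frequencies

/-- The tolerances `tol s = 4^{-(s+4)}` of the tail conditions. [folklore] -/
def tol (s : ℕ) : ℝ := 1 / 4 ^ (s + 4)

/-- The tolerances are positive. [folklore] -/
theorem tol_pos (s : ℕ) : 0 < tol s := by unfold tol; positivity

/-- `√(tol s) = 2^{-(s+4)}`. [folklore] -/
theorem sqrt_tol (s : ℕ) : Real.sqrt (tol s) = 1 / 2 ^ (s + 4) := by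
  rw [tol, show (4 : ℝ) ^ (s + 4) = (2 ^ (s + 4)) ^ 2 by rw [← pow_mul, mul_comm, pow_mul]; norm_num,
    Real.sqrt_div' _ (by positivity), Real.sqrt_sq (by positivity), Real.sqrt_one]

/-- Truncation of a frequency assignment after stage `n` (by the dummy value `1`). [folklore] -/
def trunc (g : ℕ → ℕ) (n : ℕ) : ℕ → ℕ := fun r => if r ≤ n then g r else 1

/-- Truncation does not change the stages `≤ n`. [folklore] -/
theorem trunc_apply_of_le {g : ℕ → ℕ} {n r : ℕ} (h : r ≤ n) : trunc g n r = g r := if_pos h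

namespace ProfileFamily

variable (PF : ProfileFamily) (extra : ℕ → (ℕ → ℕ) → ℕ)

/-- **The tail threshold** chosen at stage `s` for the prefix `g`: the least `K` with
`‖P_{|k · u_{s+1}| ≥ K} 𝓕Θ_{s-1}‖² ≤ tol s`. [folklore] -/
def tailK (g : ℕ → ℕ) (s : ℕ) : ℕ :=
  Nat.find (exists_tailSq_le (coef (PF.ThetaC g (s - 1))) (dir (s + 1)) (tol_pos s))

/-- The defining property of the tail threshold. [folklore] -/
theorem tailSq_tailK_le (g : ℕ → ℕ) (s : ℕ) :
    tailSq (coef (PF.ThetaC g (s - 1))) (dir (s + 1)) (PF.tailK g s) ≤ tol s :=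
  Nat.find_spec (exists_tailSq_le (coef (PF.ThetaC g (s - 1))) (dir (s + 1)) (tol_pos s))

/-- **The choice of the next frequency** given the prefix `g` of the stages `< s`: at least
`8 F_{s-1}` (lacunarity), at least the externally prescribed `extra s g` (the kinematic
constraints of the drifts), and at least `2^{s+6} (K_s + 1)` (tail threshold). [folklore] -/
def next (g : ℕ → ℕ) (s : ℕ) : ℕ := max (8 * g (s - 1)) (max (extra s g) (2 ^ (s + 6) * (PF.tailK g s + 1)))

/-- The prefixes of the frequency sequence: `pre s` is correct on the stages `≤ s` and has the
dummy value `1` beyond. [folklore] -/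
def pre : ℕ → ℕ → ℕ
  | 0 => fun _ => 1
  | s + 1 => Function.update (pre s) (s + 1) (PF.next extra (trunc (pre s) s) (s + 1))

/-- **The frequency sequence** `F s` of the cascade. [folklore] -/
def F (s : ℕ) : ℕ := PF.pre extra s s

/-- `F 0 = 1` (dummy stage; `D_1 = 1/(2F_0) = 1/2`). [folklore] -/
theorem F_zero : PF.F extra 0 = 1 := rfl

/-- The prefixes agree with the sequence on the stages they cover. [folklore] -/
theorem pre_apply_of_le {s r : ℕ} (h : r ≤ s) : PF.pre extra s r = PF.F extra r := by
  induction s with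
  | zero =>
    obtain rfl := Nat.le_zero.1 h
    rfl
  | succ s ih =>
    rcases Nat.of_le_succ h with h' | rfl
    · rw [pre, Function.update_of_ne (by omega), ih h']
    · rfl

/-- Truncated prefixes are truncations of the sequence. [folklore] -/
theorem trunc_pre (s : ℕ) : trunc (PF.pre extra s) s = trunc (PF.F extra) s := by
  funext r
  unfold trunc
  split_ifs with h
  · exact PF.pre_apply_of_le extra h
  · rfl

/-- **The recursion**: `F (s+1) = next (trunc F s) (s+1)`. [folklore] -/
theorem F_succ (s : ℕ) : PF.F extra (s + 1) = PF.next extra (trunc (PF.F extra) s) (s + 1) := by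
  change PF.pre extra (s + 1) (s + 1) = _
  rw [pre, Function.update_self, trunc_pre]

/-- States computed from a truncated assignment agree with the true ones up to the truncation. [folklore] -/
theorem Theta_trunc {s r : ℕ} (h : r ≤ s) : PF.Theta (trunc (PF.F extra) s) r = PF.Theta (PF.F extra) r :=
  PF.Theta_congr fun _ hr' => trunc_apply_of_le (hr'.trans h)

/-- The same for the complexified states. [folklore] -/
theorem ThetaC_trunc {s r : ℕ} (h : r ≤ s) : PF.ThetaC (trunc (PF.F extra) s) r = PF.ThetaC (PF.F extra) r := by
  funext x; simp only [ThetaC, PF.Theta_trunc extra h]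

/-- The tail threshold of the actual cascade at stage `s ≥ 1`. [folklore] -/
def Kseq (s : ℕ) : ℕ := PF.tailK (trunc (PF.F extra) (s - 1)) s

/-- **Lacunarity**: `8 F_{s-1} ≤ F_s` for `s ≥ 1`. [folklore] -/
theorem eight_mul_F_le {s : ℕ} (hs : 1 ≤ s) : 8 * PF.F extra (s - 1) ≤ PF.F extra s := by
  obtain ⟨n, rfl⟩ := Nat.exists_eq_add_of_le' hs
  rw [Nat.add_sub_cancel, PF.F_succ extra n, next]
  refine le_trans (le_of_eq ?_) (le_max_left _ _)
  rw [Nat.add_sub_cancel, trunc_apply_of_le le_rfl]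

/-- **The external constraints are met**: `extra s (trunc F (s-1)) ≤ F_s` for `s ≥ 1`. [folklore] -/
theorem extra_le_F {s : ℕ} (hs : 1 ≤ s) : extra s (trunc (PF.F extra) (s - 1)) ≤ PF.F extra s := by
  obtain ⟨n, rfl⟩ := Nat.exists_eq_add_of_le' hs
  rw [Nat.add_sub_cancel, PF.F_succ extra n, next]
  exact (le_max_left _ _).trans (le_max_right _ _)

/-- **The tail threshold is dominated**: `2^{s+6} (K_s + 1) ≤ F_s` for `s ≥ 1`. [folklore] -/
theorem pow_mul_Kseq_le {s : ℕ} (hs : 1 ≤ s) : 2 ^ (s + 6) * (PF.Kseq extra s + 1) ≤ PF.F extra s := by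
  obtain ⟨n, rfl⟩ := Nat.exists_eq_add_of_le' hs
  rw [Kseq, Nat.add_sub_cancel, PF.F_succ extra n, next]
  exact (le_max_right _ _).trans (le_max_right _ _)

/-- **The tail condition** at stage `s ≥ 1`: `‖P_{|k · u_{s+1}| ≥ K_s} 𝓕Θ_{s-1}‖² ≤ tol s`. [folklore] -/
theorem tailSq_Kseq_le (s : ℕ) :
    tailSq (coef (PF.ThetaC (PF.F extra) (s - 1))) (dir (s + 1)) (PF.Kseq extra s) ≤ tol s := by
  have h := PF.tailSq_tailK_le (trunc (PF.F extra) (s - 1)) s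
  rwa [PF.ThetaC_trunc extra le_rfl] at h

/-- `1 ≤ F_s`. [folklore] -/
theorem one_le_F (s : ℕ) : 1 ≤ PF.F extra s := by
  rcases Nat.eq_zero_or_pos s with rfl | hs
  · rw [F_zero]
  · have h := PF.pow_mul_Kseq_le extra hs
    have : 1 ≤ 2 ^ (s + 6) * (PF.Kseq extra s + 1) := Nat.one_le_iff_ne_zero.2 (by positivity)
    omega

/-- `0 < F_s` as a real number. [folklore] -/
theorem F_pos (s : ℕ) : (0 : ℝ) < PF.F extra s := by exact_mod_cast PF.one_le_F extra s

end ProfileFamily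

end Frequencies

/-! ## One shear stage on the coefficient side -/

section Stage

variable {θ : 𝕋² → ℂ} {i j : Fin 2} {P : ShearProfile}

/-- Smooth functions have absolutely summable coefficients. [folklore] -/
theorem summable_norm_mFourierCoeff (hθ : IsSmooth θ) : Summable fun k => ‖mFourierCoeff θ k‖ :=
  hθ.rapidDecay_mFourierCoeff.summable_norm

/-- **Unitarity**: `‖coef (θ ∘ Φ)‖ = ‖coef θ‖`. [folklore] -/
theorem norm_coef_comp_shearMap (hθ : IsSmooth θ) (hij : i ≠ j) (P : ShearProfile) :
    ‖coef (θ ∘ shearMap i j P)‖ = ‖coef θ‖ := by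
  have h1 := norm_coef_sq (hθ.comp_shearMap i j P).continuous
  have h2 := norm_coef_sq hθ.continuous
  have h3 : ∫ x, ‖(θ ∘ shearMap i j P) x‖ ^ 2 = ∫ x, ‖θ x‖ ^ 2 :=
    integral_comp_shearMap hij P fun x => ‖θ x‖ ^ 2
  have h4 : ‖coef (θ ∘ shearMap i j P)‖ ^ 2 = ‖coef θ‖ ^ 2 := by rw [h1, h3, h2]
  have := norm_nonneg (coef (θ ∘ shearMap i j P))
  have := norm_nonneg (coef θ)
  nlinarith

/-- **Fibre supports are preserved**: if `coef θ` vanishes off `{k : k_i ∈ A}` so does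
`coef (θ ∘ Φ)` (displacement direction `i`). [folklore] -/
theorem coef_comp_eq_zero_of_fibre (hθ : IsSmooth θ) (hij : i ≠ j) (P : ShearProfile) {A : Set ℤ}
    (hA : ∀ k : Mode, k i ∉ A → coef θ k = 0) {k : Mode} (hk : k i ∉ A) : coef (θ ∘ shearMap i j P) k = 0 := by
  rw [coef_apply (hθ.comp_shearMap i j P).continuous]
  exact mFourierCoeff_comp_shearMap_eq_zero_of_apply_not_mem hθ.continuous (summable_norm_mFourierCoeff hθ)
    hij P (fun k' hk' => by rw [← coef_apply hθ.continuous]; exact hA k' hk') hk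

/-- **Invariant supports in the driving direction are preserved** (`1/F`-periodic profile,
`F`-invariant set of `j`-frequencies). [folklore] -/
theorem coef_comp_eq_zero_of_invariant (hθ : IsSmooth θ) (hij : i ≠ j) {F : ℕ} (hF : 0 < F)
    (hP : ∀ t, P (t + (F : ℝ)⁻¹) = P t) {N : Set ℤ} (hN : ∀ n, n ∈ N ↔ n + F ∈ N)
    (hθN : ∀ k : Mode, k j ∉ N → coef θ k = 0) {k : Mode} (hk : k j ∉ N) : coef (θ ∘ shearMap i j P) k = 0 := by
  rw [coef_apply (hθ.comp_shearMap i j P).continuous]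
  exact mFourierCoeff_comp_shearMap_eq_zero_of_invariant hθ.continuous (summable_norm_mFourierCoeff hθ) hij hF
    hP hN (fun k' hk' => by rw [← coef_apply hθ.continuous]; exact hθN k' hk') hk

/-- **The multiplier formula** near the origin of the driving frequency. [folklore] -/
theorem coef_comp_eq_mul_of_band (hθ : IsSmooth θ) (hij : i ≠ j) {F : ℕ} (hF : 0 < F)
    (hP : ∀ t, P (t + (F : ℝ)⁻¹) = P t) (hband : ∀ k : Mode, (F : ℤ) ≤ 2 * |k j| → coef θ k = 0)
    {k : Mode} (hk : 2 * |k j| < F) :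
    coef (θ ∘ shearMap i j P) k = fourierCoeff (twist P (k i)) 0 * coef θ k := by
  rw [coef_apply (hθ.comp_shearMap i j P).continuous, coef_apply hθ.continuous]
  exact mFourierCoeff_comp_shearMap_of_band hθ.continuous (summable_norm_mFourierCoeff hθ) hij hF hP
    (fun k' hk' => by rw [← coef_apply hθ.continuous]; exact hband k' hk') hk

/-- **The near-identity estimate on the coefficient side**:
`‖coef (θ ∘ Φ) - coef θ‖ ≤ 2πκM ‖coef θ‖` when the modes of `θ` have `|k_i| ≤ κ`. [folklore] -/
theorem norm_coef_comp_sub_le (hθ : IsSmooth θ) (hij : i ≠ j) (P : ShearProfile) {κ : ℕ}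
    (hband : ∀ k : Mode, coef θ k ≠ 0 → |k i| ≤ κ) {M : ℝ} (hM : ∀ t, |P t| ≤ M) :
    ‖coef (θ ∘ shearMap i j P) - coef θ‖ ≤ 2 * Real.pi * κ * M * ‖coef θ‖ := by
  have hcomp := hθ.comp_shearMap i j P
  rw [← coef_sub hcomp.continuous hθ.continuous]
  have h1 := norm_coef_sq (hcomp.continuous.sub hθ.continuous)
  have h2 := norm_coef_sq hθ.continuous
  have h3 := integral_norm_sq_comp_shearMap_sub_le hθ hij P
    (fun k hk => hband k (by rwa [coef_apply hθ.continuous])) hM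
  have hM0 : 0 ≤ M := (abs_nonneg _).trans (hM 0)
  have h4 : ‖coef ((θ ∘ shearMap i j P) - θ)‖ ^ 2 ≤ (2 * Real.pi * κ * M * ‖coef θ‖) ^ 2 := by
    rw [h1, mul_pow, h2]
    exact h3
  have hnn : 0 ≤ 2 * Real.pi * κ * M * ‖coef θ‖ := by positivity
  exact pow_le_pow_iff_left₀ (norm_nonneg _) hnn two_ne_zero |>.1 h4

/-- **Coefficients of a composed sum**: `coef ((θ_A + θ_{Aᶜ}) ∘ Φ) = coef (θ_A ∘ Φ) + coef (θ_{Aᶜ} ∘ Φ)`. [folklore] -/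
theorem coef_comp_eq_add_modePiece (hθ : IsSmooth θ) (i j : Fin 2) (P : ShearProfile) (A : Set Mode) :
    coef (θ ∘ shearMap i j P) = coef (modePiece A θ ∘ shearMap i j P) + coef (modePiece Aᶜ θ ∘ shearMap i j P) := by
  have h := modePiece_add_modePiece_compl hθ A
  have hA := (isSmooth_modePiece hθ A).comp_shearMap i j P
  have hAc := (isSmooth_modePiece hθ Aᶜ).comp_shearMap i j P
  rw [← coef_add hA.continuous hAc.continuous]
  congr 1
  funext x
  simp only [Function.comp_apply, Pi.add_apply]
  rw [← Pi.add_apply (modePiece A θ) (modePiece Aᶜ θ), h]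

/-- **Bands through a stage.** If a set of modes `S` and its complement are both preserved by
the stage (as supports of coefficient families), then `P_S coef(θ ∘ Φ) = coef(θ_S ∘ Φ)` and in
particular `‖P_S coef(θ ∘ Φ)‖ = ‖P_S coef θ‖`. [folklore] -/
theorem band_coef_comp_of_preserved (hθ : IsSmooth θ) (i j : Fin 2) (P : ShearProfile) {S : Set Mode}
    (hS : ∀ {φ : 𝕋² → ℂ}, IsSmooth φ → (∀ k ∉ S, coef φ k = 0) → ∀ k ∉ S, coef (φ ∘ shearMap i j P) k = 0)
    (hSc : ∀ {φ : 𝕋² → ℂ}, IsSmooth φ → (∀ k ∈ S, coef φ k = 0) → ∀ k ∈ S, coef (φ ∘ shearMap i j P) k = 0) :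
    band S (coef (θ ∘ shearMap i j P)) = coef (modePiece S θ ∘ shearMap i j P) := by
  rw [coef_comp_eq_add_modePiece hθ i j P S, band_add]
  have h1 : band S (coef (modePiece S θ ∘ shearMap i j P)) = coef (modePiece S θ ∘ shearMap i j P) :=
    band_eq_self (hS (isSmooth_modePiece hθ S) fun k hk => by
      rw [coef_apply (isSmooth_modePiece hθ S).continuous, mFourierCoeff_modePiece hθ, Set.indicator_of_notMem hk])
  have h2 : band S (coef (modePiece Sᶜ θ ∘ shearMap i j P)) = 0 :=
    band_eq_zero (hSc (isSmooth_modePiece hθ Sᶜ) fun k hk => by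
      rw [coef_apply (isSmooth_modePiece hθ Sᶜ).continuous, mFourierCoeff_modePiece hθ,
        Set.indicator_of_notMem (Set.notMem_compl_iff.2 hk)])
  rw [h1, h2, add_zero]

/-- Norm form of `band_coef_comp_of_preserved`. [folklore] -/
theorem norm_band_coef_comp_of_preserved (hθ : IsSmooth θ) (hij : i ≠ j) (P : ShearProfile) {S : Set Mode}
    (hS : ∀ {φ : 𝕋² → ℂ}, IsSmooth φ → (∀ k ∉ S, coef φ k = 0) → ∀ k ∉ S, coef (φ ∘ shearMap i j P) k = 0)
    (hSc : ∀ {φ : 𝕋² → ℂ}, IsSmooth φ → (∀ k ∈ S, coef φ k = 0) → ∀ k ∈ S, coef (φ ∘ shearMap i j P) k = 0) :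
    ‖band S (coef (θ ∘ shearMap i j P))‖ = ‖band S (coef θ)‖ := by
  rw [band_coef_comp_of_preserved hθ i j P hS hSc, norm_coef_comp_shearMap (isSmooth_modePiece hθ S) hij P,
    band_coef hθ S]

/-- **Fibre bands through a stage**: `‖P_{k_i ∈ A} coef(θ ∘ Φ)‖ = ‖P_{k_i ∈ A} coef θ‖`. [folklore] -/
theorem norm_band_fibre_comp (hθ : IsSmooth θ) (hij : i ≠ j) (P : ShearProfile) (A : Set ℤ) :
    ‖band {k : Mode | k i ∈ A} (coef (θ ∘ shearMap i j P))‖ = ‖band {k : Mode | k i ∈ A} (coef θ)‖ := by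
  refine norm_band_coef_comp_of_preserved hθ hij P (fun hφ h0 k hk => ?_) (fun hφ h0 k hk => ?_)
  · exact coef_comp_eq_zero_of_fibre hφ hij P (A := A) (fun k' hk' => h0 k' hk') hk
  · refine coef_comp_eq_zero_of_fibre hφ hij P (A := Aᶜ) (fun k' hk' => h0 k' ?_) ?_
    · simpa using hk'
    · simpa using hk

/-- **Invariant bands through a stage**: `‖P_{k_j ∈ N} coef(θ ∘ Φ)‖ = ‖P_{k_j ∈ N} coef θ‖` for an
`F`-invariant `N` and a `1/F`-periodic profile. [folklore] -/
theorem norm_band_invariant_comp (hθ : IsSmooth θ) (hij : i ≠ j) {F : ℕ} (hF : 0 < F)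
    (hP : ∀ t, P (t + (F : ℝ)⁻¹) = P t) {N : Set ℤ} (hN : ∀ n, n ∈ N ↔ n + F ∈ N) :
    ‖band {k : Mode | k j ∈ N} (coef (θ ∘ shearMap i j P))‖ = ‖band {k : Mode | k j ∈ N} (coef θ)‖ := by
  have hNc : ∀ n, n ∈ Nᶜ ↔ n + F ∈ Nᶜ := fun n => by simp only [Set.mem_compl_iff, hN n]
  refine norm_band_coef_comp_of_preserved hθ hij P (fun hφ h0 k hk => ?_) (fun hφ h0 k hk => ?_)
  · exact coef_comp_eq_zero_of_invariant hφ hij hF hP hN (fun k' hk' => h0 k' hk') hk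
  · refine coef_comp_eq_zero_of_invariant hφ hij hF hP hNc (fun k' hk' => h0 k' ?_) ?_
    · simpa using hk'
    · simpa using hk

end Stage

/-! ## The actual cascade: stage data -/

namespace ProfileFamily

variable (PF : ProfileFamily) (extra : ℕ → (ℕ → ℕ) → ℕ)

/-- The complexified states of the actual cascade. [folklore] -/
def Θc (s : ℕ) : 𝕋² → ℂ := PF.ThetaC (PF.F extra) s

/-- Their coefficient families. [folklore] -/
def cf (s : ℕ) : El2 := coef (PF.Θc extra s)

/-- The stage profiles of the actual cascade. [folklore] -/
def stP (s : ℕ) : ShearProfile := PF.stageProfile (PF.F extra) s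

/-- The low-frequency boxes `Low m = {k : 4|k_l| < F_m for both l}`. [folklore] -/
def Low (m : ℕ) : Set Mode := {k | ∀ l, 4 * |k l| < PF.F extra m}

/-- The states are smooth. [folklore] -/
theorem isSmooth_Θc (s : ℕ) : IsSmooth (PF.Θc extra s) := PF.isSmooth_ThetaC _ s

/-- The recursion `Θ_{s+1} = Θ_s ∘ Φ_{s+1}`. [folklore] -/
theorem Θc_succ (s : ℕ) : PF.Θc extra (s + 1) = PF.Θc extra s ∘ shearMap (dir (s + 1)) (dir (s + 2)) (PF.stP extra (s + 1)) :=
  PF.ThetaC_succ _ s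

/-- `‖cf s‖ = 1`. [folklore] -/
theorem norm_cf (s : ℕ) : ‖PF.cf extra s‖ = 1 := PF.norm_coef_ThetaC _ s

/-- Unfolding `cf`. [folklore] -/
theorem cf_eq (s : ℕ) : PF.cf extra s = coef (PF.Θc extra s) := rfl

/-- The stage profile of stage `s ≥ 1` is `1/F_s`-periodic. [folklore] -/
theorem stP_add_inv (s : ℕ) (t : ℝ) : PF.stP extra s (t + ((PF.F extra s : ℕ) : ℝ)⁻¹) = PF.stP extra s t :=
  (PF.prof s).scale_add_inv _ (PF.one_le_F extra s) t

/-- The displacement of stage `s` is `D_s = 1/(2F_{s-1}) > 0`. [folklore] -/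
theorem disp_pos (s : ℕ) : 0 < disp (PF.F extra) s := by
  unfold disp
  have := PF.F_pos extra (s - 1)
  positivity

/-- `|stage profile| ≤ D_s`. [folklore] -/
theorem abs_stP_le (s : ℕ) (t : ℝ) : |PF.stP extra s t| ≤ disp (PF.F extra) s := by
  have h := (PF.prof s).abs_scale_le (disp (PF.F extra) s) (PF.F extra s) (PF.abs_le_one s) t
  rwa [abs_of_pos (PF.disp_pos extra s), mul_one] at h

/-- **The multiplier of stage `s`** read by the mode with `i`-frequency `n = q + l F_{s-1}`: the
oscillatory mean of `S_s` at the phase `l/2 + q/(2F_{s-1})`. [folklore] -/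
theorem fourierCoeff_twist_stP (s : ℕ) (n : ℤ) :
    fourierCoeff (twist (PF.stP extra s) n) 0 =
      ∫ t in (0 : ℝ)..1, Complex.exp (-(2 * Real.pi * Complex.I * ((n : ℝ) * disp (PF.F extra) s) * PF.prof s t)) := by
  rw [stP, stageProfile, fourierCoeff_twist_scale_zero _ _ (PF.one_le_F extra s)]
  refine intervalIntegral.integral_congr fun t _ => ?_
  push_cast
  ring_nf

/-- **Residue bound for the stage multipliers**: if `n = q + l F_{s-1}` with `l ≠ 0` and
`|q| ≤ F_{s-1}/4`... precisely `4|q| ≤ 2F_{s-1}`, then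
`|ĝ_n(0)| ≤ 4 |q|/(2F_{s-1}) + res s`. [folklore] -/
theorem norm_fourierCoeff_twist_stP_le (s : ℕ) {q l : ℤ} (hl : l ≠ 0)
    (hq : |(q : ℝ)| * disp (PF.F extra) s ≤ 4⁻¹) :
    ‖fourierCoeff (twist (PF.stP extra s) (q + l * PF.F extra (s - 1))) 0‖ ≤
      4 * (|(q : ℝ)| * disp (PF.F extra) s) + PF.res s := by
  rw [PF.fourierCoeff_twist_stP extra s]
  have hF := PF.F_pos extra (s - 1)
  have hD : disp (PF.F extra) s = 1 / (2 * PF.F extra (s - 1)) := rfl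
  have hphase : (((q + l * PF.F extra (s - 1) : ℤ) : ℝ) * disp (PF.F extra) s) = (l : ℝ) / 2 + q * disp (PF.F extra) s := by
    rw [hD]; push_cast; field_simp; ring
  have h := PF.oscMean_le s l hl (q * disp (PF.F extra) s) (by rwa [abs_mul, abs_of_pos (PF.disp_pos extra s)])
  rw [abs_mul, abs_of_pos (PF.disp_pos extra s)] at h
  convert h using 4
  have e : ((((q + l * PF.F extra (s - 1) : ℤ) : ℝ) : ℂ) * ((disp (PF.F extra) s : ℝ) : ℂ)) =
      (((l : ℝ) : ℂ) / 2 + (((q : ℝ) * disp (PF.F extra) s : ℝ) : ℂ)) := by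
    have := congrArg (fun r : ℝ => (r : ℂ)) hphase
    push_cast at this ⊢
    exact this
  rw [e]

/-! ## The constants -/

/-- `4 K_m ≤ F_m` for `m ≥ 1`. [folklore] -/
theorem four_mul_Kseq_le {m : ℕ} (hm : 1 ≤ m) : 4 * PF.Kseq extra m ≤ PF.F extra m := by
  have h := PF.pow_mul_Kseq_le extra hm
  have h4 : 4 ≤ 2 ^ (m + 6) := by
    calc (4 : ℕ) = 2 ^ 2 := by norm_num
      _ ≤ 2 ^ (m + 6) := Nat.pow_le_pow_right (by norm_num) (by omega)
  calc 4 * PF.Kseq extra m ≤ 2 ^ (m + 6) * (PF.Kseq extra m + 1) := Nat.mul_le_mul h4 (Nat.le_succ _)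
    _ ≤ PF.F extra m := h

/-- `π K_m / F_m ≤ 2^{-(m+4)}` for `m ≥ 1` (the near-identity factor of stage `m+1` on the
`K_m`-band). [folklore] -/
theorem pi_mul_Kseq_div_le {m : ℕ} (hm : 1 ≤ m) :
    Real.pi * PF.Kseq extra m / PF.F extra m ≤ 1 / 2 ^ (m + 4) := by
  have h := PF.pow_mul_Kseq_le extra hm
  have hF := PF.F_pos extra m
  have h' : (2 : ℝ) ^ (m + 6) * (PF.Kseq extra m + 1) ≤ PF.F extra m := by exact_mod_cast h
  rw [div_le_div_iff₀ hF (by positivity), one_mul]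
  have hπ : Real.pi ≤ 4 := Real.pi_le_four
  have hK : (0 : ℝ) ≤ PF.Kseq extra m := Nat.cast_nonneg _
  calc Real.pi * PF.Kseq extra m * 2 ^ (m + 4) ≤ 4 * (PF.Kseq extra m + 1) * 2 ^ (m + 4) := by gcongr; linarith
    _ = 2 ^ (m + 6) * (PF.Kseq extra m + 1) := by ring
    _ ≤ PF.F extra m := h'

/-- `K_m D_{m+1} ≤ 2^{-(m+7)}` (the phase offsets seen at stage `m+1` are tiny). [folklore] -/
theorem Kseq_mul_disp_le {m : ℕ} (hm : 1 ≤ m) :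
    (PF.Kseq extra m : ℝ) * disp (PF.F extra) (m + 1) ≤ 1 / 2 ^ (m + 7) := by
  have h := PF.pow_mul_Kseq_le extra hm
  have hF := PF.F_pos extra m
  have h' : (2 : ℝ) ^ (m + 6) * (PF.Kseq extra m + 1) ≤ PF.F extra m := by exact_mod_cast h
  rw [disp, Nat.add_sub_cancel, ← mul_div_assoc, mul_one, div_le_div_iff₀ (by positivity) (by positivity), one_mul]
  have hK : (0 : ℝ) ≤ PF.Kseq extra m := Nat.cast_nonneg _
  calc (PF.Kseq extra m : ℝ) * 2 ^ (m + 7) ≤ (PF.Kseq extra m + 1) * 2 ^ (m + 7) := by gcongr; linarith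
    _ = 2 * (2 ^ (m + 6) * (PF.Kseq extra m + 1)) := by ring
    _ ≤ 2 * PF.F extra m := by linarith

end ProfileFamily

/-! ## Key lemma 1: the low modes freeze -/

namespace ProfileFamily

variable (PF : ProfileFamily) (extra : ℕ → (ℕ → ℕ) → ℕ)

/-- The union bound for band norms. [folklore] -/
theorem _root_.Literature.Analysis.FluidPDE.ShearCascade.norm_band_union_le (A B : Set Mode) (f : El2) :
    ‖band (A ∪ B) f‖ ≤ ‖band A f‖ + ‖band B f‖ := by
  have h : band (A ∪ B) f = band A f + band (B \ A) f := by
    apply lp.ext; funext k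
    simp only [lp.coeFn_add, Pi.add_apply, band_apply]
    by_cases hA : k ∈ A <;> by_cases hB : k ∈ B <;> simp [hA, hB]
  rw [h]
  exact (norm_add_le _ _).trans (add_le_add le_rfl (norm_band_mono Set.sdiff_subset f))

/-- The band of a difference restricted to a set where both families are supported elsewhere. [folklore] -/
theorem _root_.Literature.Analysis.FluidPDE.ShearCascade.norm_sqrt_tailSq (f : El2) (i : Fin 2) (K : ℕ) :
    ‖band (tailSet i K) f‖ = Real.sqrt (tailSq f i K) := by
  rw [tailSq, Real.sqrt_sq (norm_nonneg _)]

/-- **The bad `j`-frequencies of stage `m`**: those not within `K_m` of a multiple of `F_m`. [folklore] -/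
def Nbad (m : ℕ) : Set ℤ := {n | ∀ c : ℤ, (PF.Kseq extra m : ℤ) ≤ |n + c * PF.F extra m|}

/-- `Nbad m` is invariant under the shift by `F_m`. [folklore] -/
theorem Nbad_invariant (m : ℕ) (n : ℤ) : n ∈ PF.Nbad extra m ↔ n + (PF.F extra m : ℕ) ∈ PF.Nbad extra m := by
  constructor
  · intro h c
    have := h (c + 1)
    rw [show n + (PF.F extra m : ℕ) + c * PF.F extra m = n + (c + 1) * PF.F extra m by ring]
    exact this
  · intro h c
    have := h (c - 1)
    rw [show n + (PF.F extra m : ℕ) + (c - 1) * PF.F extra m = n + c * PF.F extra m by ring] at this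
    exact this

/-- Bad frequencies are at least `K_m` in size. [folklore] -/
theorem Kseq_le_abs_of_mem_Nbad {m : ℕ} {n : ℤ} (h : n ∈ PF.Nbad extra m) : (PF.Kseq extra m : ℤ) ≤ |n| := by
  simpa using h 0

/-- **The in-between band is bad**: `K_m ≤ |n|` and `4|n| < F_m` imply `n ∈ Nbad m` (`m ≥ 1`). [folklore] -/
theorem mem_Nbad {m : ℕ} (hm : 1 ≤ m) {n : ℤ} (h1 : (PF.Kseq extra m : ℤ) ≤ |n|) (h2 : 4 * |n| < PF.F extra m) :
    n ∈ PF.Nbad extra m := by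
  intro c
  have h4 : (4 * PF.Kseq extra m : ℕ) ≤ PF.F extra m := PF.four_mul_Kseq_le extra hm
  have h4' : (4 : ℤ) * PF.Kseq extra m ≤ PF.F extra m := by exact_mod_cast h4
  by_cases hc : c = 0
  · simpa [hc] using h1
  · have hc1 : (1 : ℤ) ≤ |c| := Int.one_le_abs hc
    have hF0 : (0 : ℤ) ≤ PF.F extra m := by positivity
    have htri : |c * (PF.F extra m : ℤ)| - |n| ≤ |n + c * PF.F extra m| := by
      have := abs_sub_abs_le_abs_sub (c * (PF.F extra m : ℤ)) (-n)
      rwa [abs_neg, sub_neg_eq_add, add_comm] at this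
    rw [abs_mul, abs_of_nonneg hF0] at htri
    nlinarith

/-- **The bad band is small**: `‖P_{k · u_{m+1} ∈ Nbad m} cf m‖ ≤ 2^{-(m+4)}` for `m ≥ 1` — the
bad set is `F_m`-invariant, so the band passes through stage `m` unchanged in norm, and before
stage `m` it lies in the tail controlled by the choice of `F_m`. [folklore] -/
theorem norm_band_Nbad_le {m : ℕ} (hm : 1 ≤ m) :
    ‖band {k : Mode | k (dir (m + 1)) ∈ PF.Nbad extra m} (PF.cf extra m)‖ ≤ 1 / 2 ^ (m + 4) := by
  obtain ⟨n, rfl⟩ := Nat.exists_eq_add_of_le' hm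
  have hstage := PF.Θc_succ extra n
  rw [cf_eq, hstage, norm_band_invariant_comp (PF.isSmooth_Θc extra n) (dir_succ_ne (n + 1)).symm
    (PF.one_le_F extra (n + 1)) (PF.stP_add_inv extra (n + 1)) (PF.Nbad_invariant extra (n + 1))]
  have hsub : {k : Mode | k (dir (n + 1 + 1)) ∈ PF.Nbad extra (n + 1)} ⊆ tailSet (dir (n + 1 + 1)) (PF.Kseq extra (n + 1)) :=
    fun k hk => PF.Kseq_le_abs_of_mem_Nbad extra hk
  refine (norm_band_mono hsub _).trans ?_
  rw [norm_sqrt_tailSq, ← sqrt_tol]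
  refine Real.sqrt_le_sqrt ?_
  have h := PF.tailSq_Kseq_le extra (n + 1)
  rwa [Nat.add_sub_cancel] at h

/-- **Key lemma 1 (the low modes freeze).** For `m ≥ 1`,
`‖P_{Low m} (cf (m+1) - cf m)‖ ≤ 3 · 2^{-(m+4)}`: split `Θ_m` spectrally by the
`u_{m+1}`-frequency into `|k_i| < K_m` (near-identity estimate: factor `π K_m/F_m ≤ 2^{-(m+4)}`),
the bad band `K_m ≤ |k_i| < F_m/4` (mass `≤ 2^{-(m+4)}` before and after the stage) and the front
`|k_i| ≥ F_m/4` (invisible in `Low m` before and after the stage). [folklore] -/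
theorem norm_band_Low_sub_le {m : ℕ} (hm : 1 ≤ m) :
    ‖band (PF.Low extra m) (PF.cf extra (m + 1) - PF.cf extra m)‖ ≤ 3 / 2 ^ (m + 4) := by
  -- notation
  set i : Fin 2 := dir (m + 1) with hi
  set j : Fin 2 := dir (m + 2) with hj
  have hij : i ≠ j := (dir_succ_ne (m + 1)).symm
  set θ := PF.Θc extra m with hθ_def
  have hθ : IsSmooth θ := PF.isSmooth_Θc extra m
  set P := PF.stP extra (m + 1) with hP_def
  set K : ℕ := PF.Kseq extra m with hK_def
  set Fm : ℕ := PF.F extra m with hFm_def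
  have hsucc : PF.cf extra (m + 1) = coef (θ ∘ shearMap i j P) := by
    rw [cf_eq, PF.Θc_succ extra m]
  have hcfm : PF.cf extra m = coef θ := rfl
  -- the three spectral regions in the direction `i`
  set S₁ : Set Mode := {k | |k i| < K} with hS₁
  set S₃ : Set Mode := {k | (Fm : ℤ) ≤ 4 * |k i|} with hS₃
  have h4K : (4 * K : ℕ) ≤ Fm := PF.four_mul_Kseq_le extra hm
  have h4K' : (4 : ℤ) * K ≤ Fm := by exact_mod_cast h4K
  -- pieces
  set g₁ := modePiece S₁ θ with hg₁
  set g' := modePiece S₁ᶜ θ with hg'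
  have hg₁s : IsSmooth g₁ := isSmooth_modePiece hθ _
  have hg's : IsSmooth g' := isSmooth_modePiece hθ _
  set h₃ := modePiece S₃ g' with hh₃
  set h₂ := modePiece S₃ᶜ g' with hh₂
  have hh₃s : IsSmooth h₃ := isSmooth_modePiece hg's _
  have hh₂s : IsSmooth h₂ := isSmooth_modePiece hg's _
  -- coefficient decompositions before and after the stage
  have hdec1 : coef (θ ∘ shearMap i j P) = coef (g₁ ∘ shearMap i j P) + coef (g' ∘ shearMap i j P) :=
    coef_comp_eq_add_modePiece hθ i j P S₁
  have hdec2 : coef (g' ∘ shearMap i j P) = coef (h₃ ∘ shearMap i j P) + coef (h₂ ∘ shearMap i j P) :=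
    coef_comp_eq_add_modePiece hg's i j P S₃
  have hdec3 : coef θ = coef g₁ + coef g' := by
    rw [← coef_add hg₁s.continuous hg's.continuous, modePiece_add_modePiece_compl hθ]
  have hdec4 : coef g' = coef h₃ + coef h₂ := by
    rw [← coef_add hh₃s.continuous hh₂s.continuous, modePiece_add_modePiece_compl hg's]
  -- (1) the near-identity part
  have hband₁ : ∀ k : Mode, coef g₁ k ≠ 0 → |k i| ≤ K := by
    intro k hk
    rw [coef_apply hg₁s.continuous, mFourierCoeff_modePiece hθ] at hk
    by_contra h
    exact hk (Set.indicator_of_notMem (by simp [hS₁]; omega) _)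
  have hD := PF.abs_stP_le extra (m + 1)
  have h1 : ‖coef (g₁ ∘ shearMap i j P) - coef g₁‖ ≤ 1 / 2 ^ (m + 4) := by
    refine (norm_coef_comp_sub_le hg₁s hij P hband₁ hD).trans ?_
    have hng₁ : ‖coef g₁‖ ≤ 1 := by
      rw [← band_coef hθ S₁, ← hcfm]
      exact (norm_band_le _ _).trans (PF.norm_cf extra m).le
    have hdisp : disp (PF.F extra) (m + 1) = 1 / (2 * Fm) := by simp [disp, hFm_def]
    have hFpos : (0 : ℝ) < Fm := PF.F_pos extra m
    have hkey := PF.pi_mul_Kseq_div_le extra hm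
    rw [← hK_def, ← hFm_def] at hkey
    calc 2 * Real.pi * K * disp (PF.F extra) (m + 1) * ‖coef g₁‖ ≤ 2 * Real.pi * K * disp (PF.F extra) (m + 1) * 1 := by
          gcongr
          · exact mul_nonneg (by positivity) (PF.disp_pos extra (m + 1)).le
      _ = Real.pi * K / Fm := by rw [hdisp]; field_simp
      _ ≤ 1 / 2 ^ (m + 4) := hkey
  -- (2) the bad band
  have hh₂_eq : coef h₂ = band (S₃ᶜ ∩ S₁ᶜ) (coef θ) := by
    rw [← band_coef hg's, hg', ← band_coef hθ, band_band]
  have hsub₂ : S₃ᶜ ∩ S₁ᶜ ⊆ {k : Mode | k i ∈ PF.Nbad extra m} := by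
    intro k hk
    simp only [Set.mem_inter_iff, Set.mem_compl_iff, hS₃, hS₁, Set.mem_setOf_eq, not_le, not_lt] at hk
    exact PF.mem_Nbad extra hm hk.2 hk.1
  have h2 : ‖coef h₂‖ ≤ 1 / 2 ^ (m + 4) := by
    rw [hh₂_eq]
    exact (norm_band_mono hsub₂ _).trans (PF.norm_band_Nbad_le extra hm)
  have h2' : ‖coef (h₂ ∘ shearMap i j P)‖ ≤ 1 / 2 ^ (m + 4) := by
    rw [norm_coef_comp_shearMap hh₂s hij P]; exact h2
  -- (3) the front is invisible in `Low m`
  have hLowS₃ : ∀ k ∈ PF.Low extra m, k ∉ S₃ := by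
    intro k hk hk3
    have := hk i
    simp only [hS₃, Set.mem_setOf_eq] at hk3
    rw [← hFm_def] at this
    omega
  have hsupp_h₃ : ∀ k ∉ S₃, coef h₃ k = 0 := fun k hk => by
    rw [coef_apply hh₃s.continuous, mFourierCoeff_modePiece hg's, Set.indicator_of_notMem hk]
  have hsupp_h₃' : ∀ k ∉ S₃, coef (h₃ ∘ shearMap i j P) k = 0 := fun k hk =>
    coef_comp_eq_zero_of_fibre hh₃s hij P (A := {n : ℤ | (Fm : ℤ) ≤ 4 * |n|}) (fun k' hk' => hsupp_h₃ k' hk') hk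
  have h3a : band (PF.Low extra m) (coef h₃) = 0 := band_eq_zero fun k hk => hsupp_h₃ k (hLowS₃ k hk)
  have h3b : band (PF.Low extra m) (coef (h₃ ∘ shearMap i j P)) = 0 :=
    band_eq_zero fun k hk => hsupp_h₃' k (hLowS₃ k hk)
  -- assemble
  have hdiff : PF.cf extra (m + 1) - PF.cf extra m =
      (coef (g₁ ∘ shearMap i j P) - coef g₁) + (coef (h₃ ∘ shearMap i j P) - coef h₃) +
        (coef (h₂ ∘ shearMap i j P) - coef h₂) := by
    rw [hsucc, hcfm, hdec1, hdec2, hdec3, hdec4]; abel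
  rw [hdiff, band_add, band_add, band_sub _ (coef (h₃ ∘ shearMap i j P)), h3a, h3b, sub_zero, add_zero]
  calc ‖band (PF.Low extra m) (coef (g₁ ∘ shearMap i j P) - coef g₁) +
        band (PF.Low extra m) (coef (h₂ ∘ shearMap i j P) - coef h₂)‖
      ≤ ‖band (PF.Low extra m) (coef (g₁ ∘ shearMap i j P) - coef g₁)‖ +
        ‖band (PF.Low extra m) (coef (h₂ ∘ shearMap i j P) - coef h₂)‖ := norm_add_le _ _
    _ ≤ ‖coef (g₁ ∘ shearMap i j P) - coef g₁‖ + ‖coef (h₂ ∘ shearMap i j P) - coef h₂‖ :=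
        add_le_add (norm_band_le _ _) (norm_band_le _ _)
    _ ≤ 1 / 2 ^ (m + 4) + (1 / 2 ^ (m + 4) + 1 / 2 ^ (m + 4)) :=
        add_le_add h1 ((norm_sub_le _ _).trans (add_le_add h2' h2))
    _ = 3 / 2 ^ (m + 4) := by ring

end ProfileFamily

/-! ## Key lemma 2: the front persists -/

namespace ProfileFamily

variable (PF : ProfileFamily) (extra : ℕ → (ℕ → ℕ) → ℕ)

/-- **The front** after stage `m`: the modes with `u_{m+1}`-frequency at least `F_m/4`. [folklore] -/
def Front (m : ℕ) : Set Mode := {k | (PF.F extra m : ℤ) ≤ 4 * |k (dir (m + 1))|}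

/-- The energy carried by the front. [folklore] -/
def β (m : ℕ) : ℝ := ‖band (PF.Front extra m) (PF.cf extra m)‖ ^ 2

/-- `β m ≤ 1`. [folklore] -/
theorem β_le_one (m : ℕ) : PF.β extra m ≤ 1 := by
  unfold β
  have h := norm_band_le (PF.Front extra m) (PF.cf extra m)
  rw [PF.norm_cf] at h
  nlinarith [norm_nonneg (band (PF.Front extra m) (PF.cf extra m))]

/-- `‖P_{(Front m)ᶜ} cf m‖² = 1 - β m`. [folklore] -/
theorem norm_sq_band_compl_Front (m : ℕ) : ‖band (PF.Front extra m)ᶜ (PF.cf extra m)‖ ^ 2 = 1 - PF.β extra m := by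
  have h := norm_sq_band_add_compl (PF.Front extra m) (PF.cf extra m)
  rw [PF.norm_cf, one_pow] at h
  unfold β; linarith

/-- **The multipliers seen by the front are small.** At stage `m+1` (`m ≥ 1`), a front mode whose
`u_{m+1}`-frequency `n` is *good* (within `K_m` of a multiple `-l F_m` of `F_m`, necessarily
with `l ≠ 0`) reads the multiplier `ĝ_n(0)` of absolute value `≤ 2^{-(m+4)}`. [folklore] -/
theorem norm_multiplier_front_le {m : ℕ} (hm : 1 ≤ m) {n : ℤ} (hfront : (PF.F extra m : ℤ) ≤ 4 * |n|)
    (hgood : n ∉ PF.Nbad extra m) :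
    ‖fourierCoeff (twist (PF.stP extra (m + 1)) n) 0‖ ≤ 1 / 2 ^ (m + 4) := by
  simp only [Nbad, Set.mem_setOf_eq, not_forall, not_le] at hgood
  obtain ⟨c, hc⟩ := hgood
  set q : ℤ := n + c * PF.F extra m with hq_def
  have hn : n = q + (-c) * PF.F extra (m + 1 - 1) := by rw [Nat.add_sub_cancel, hq_def]; ring
  have hl : (-c) ≠ 0 := by
    intro h0
    have hc0 : c = 0 := by simpa using h0
    have hq0 : q = n := by rw [hq_def, hc0, zero_mul, add_zero]
    rw [hq0] at hc
    have h4 : (4 : ℤ) * PF.Kseq extra m ≤ PF.F extra m := by exact_mod_cast PF.four_mul_Kseq_le extra hm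
    omega
  have hqK : |(q : ℝ)| ≤ PF.Kseq extra m := by
    have : |q| ≤ (PF.Kseq extra m : ℤ) := hc.le
    exact_mod_cast this
  have hKD := PF.Kseq_mul_disp_le extra hm
  have hDpos := PF.disp_pos extra (m + 1)
  have hqD : |(q : ℝ)| * disp (PF.F extra) (m + 1) ≤ 1 / 2 ^ (m + 7) :=
    (mul_le_mul_of_nonneg_right hqK hDpos.le).trans hKD
  have hqD' : |(q : ℝ)| * disp (PF.F extra) (m + 1) ≤ 4⁻¹ := hqD.trans (by
    rw [div_le_iff₀ (by positivity)]
    have : (4 : ℝ) ≤ 2 ^ (m + 7) := by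
      calc (4 : ℝ) = 2 ^ 2 := by norm_num
        _ ≤ 2 ^ (m + 7) := pow_le_pow_right₀ (by norm_num) (by omega)
    linarith)
  rw [hn]
  refine (PF.norm_fourierCoeff_twist_stP_le extra (m + 1) hl hqD').trans ?_
  have hres := PF.res_le (m + 1)
  calc 4 * (|(q : ℝ)| * disp (PF.F extra) (m + 1)) + PF.res (m + 1) ≤ 4 * (1 / 2 ^ (m + 7)) + 1 / 2 ^ (m + 1 + 4) := by
        gcongr
    _ = 1 / 2 ^ (m + 4) := by rw [show m + 1 + 4 = m + 5 by ring]; field_simp; ring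

/-- **Key lemma 2 (the front persists).** For `m ≥ 1`, `β (m+1) ≥ β m - 9 · 4^{-(m+4)}`:
after stage `m+1` the new front `{|k_j| ≥ F_{m+1}/4}` misses only what the stage left at
`|k_j| < F_{m+1}/4`; of the old front's image, that is at most the unscattered part of the good
modes (multipliers `≤ 2^{-(m+4)}`) plus the bad and tail modes (`≤ 2^{-(m+4)} + 2^{-(m+5)}`);
everything else at `|k_j| < F_{m+1}/4` comes from the old front's complement, of energy `1 - β m`. [folklore] -/
theorem β_succ_ge {m : ℕ} (hm : 1 ≤ m) : PF.β extra m - 9 / 4 ^ (m + 4) ≤ PF.β extra (m + 1) := by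
  -- notation
  set i : Fin 2 := dir (m + 1) with hi
  set j : Fin 2 := dir (m + 2) with hj
  have hij : i ≠ j := (dir_succ_ne (m + 1)).symm
  have hji : dir (m + 1 + 1) = j := rfl
  set θ := PF.Θc extra m with hθ_def
  have hθ : IsSmooth θ := PF.isSmooth_Θc extra m
  set P := PF.stP extra (m + 1) with hP_def
  set K : ℕ := PF.Kseq extra m with hK_def
  set K' : ℕ := PF.Kseq extra (m + 1) with hK'_def
  set Fm : ℕ := PF.F extra m with hFm_def
  set Fm1 : ℕ := PF.F extra (m + 1) with hFm1_def
  have hsucc : PF.cf extra (m + 1) = coef (θ ∘ shearMap i j P) := by rw [cf_eq, PF.Θc_succ extra m]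
  have hcfm : PF.cf extra m = coef θ := rfl
  have h4K' : (4 : ℤ) * K' ≤ Fm1 := by exact_mod_cast PF.four_mul_Kseq_le extra (by omega : 1 ≤ m + 1)
  -- the old front and its complement
  set Fr : Set Mode := PF.Front extra m with hFr
  have hFr_eq : Fr = {k : Mode | k i ∈ {n : ℤ | (Fm : ℤ) ≤ 4 * |n|}} := rfl
  set g₃ := modePiece Fr θ with hg₃
  set gT := modePiece Frᶜ θ with hgT
  have hg₃s : IsSmooth g₃ := isSmooth_modePiece hθ _
  have hgTs : IsSmooth gT := isSmooth_modePiece hθ _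
  have hdec : coef (θ ∘ shearMap i j P) = coef (g₃ ∘ shearMap i j P) + coef (gT ∘ shearMap i j P) :=
    coef_comp_eq_add_modePiece hθ i j P Fr
  -- supports after the stage
  have hsupp₃ : ∀ k : Mode, k i ∉ {n : ℤ | (Fm : ℤ) ≤ 4 * |n|} → coef (g₃ ∘ shearMap i j P) k = 0 := fun k hk =>
    coef_comp_eq_zero_of_fibre hg₃s hij P (fun k' hk' => by
      rw [coef_apply hg₃s.continuous, mFourierCoeff_modePiece hθ]
      exact Set.indicator_of_notMem (by rw [hFr_eq]; exact hk') _) hk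
  have hsuppT : ∀ k : Mode, k i ∉ {n : ℤ | (Fm : ℤ) ≤ 4 * |n|}ᶜ → coef (gT ∘ shearMap i j P) k = 0 := fun k hk =>
    coef_comp_eq_zero_of_fibre hgTs hij P (A := {n : ℤ | (Fm : ℤ) ≤ 4 * |n|}ᶜ) (fun k' hk' => by
      rw [coef_apply hgTs.continuous, mFourierCoeff_modePiece hθ]
      refine Set.indicator_of_notMem (fun hmem => hk' ?_) _
      rw [Set.mem_compl_iff, hFr_eq] at hmem
      exact hmem) hk
  -- the new front's complement `T'`
  set T' : Set Mode := (PF.Front extra (m + 1))ᶜ with hT'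
  have hT'_mem : ∀ k : Mode, k ∈ T' ↔ 4 * |k j| < Fm1 := fun k => by
    simp [hT', Front, hji, hFm1_def, not_le]
  -- Pythagoras across the two supports
  have hdisj : ∀ k : Mode, band T' (coef (g₃ ∘ shearMap i j P)) k = 0 ∨ band T' (coef (gT ∘ shearMap i j P)) k = 0 := by
    intro k
    by_cases hk : k i ∈ {n : ℤ | (Fm : ℤ) ≤ 4 * |n|}
    · right; simp [band_apply, hsuppT k (by simpa using hk)]
    · left; simp [band_apply, hsupp₃ k hk]
  have hβ1 : PF.β extra (m + 1) = 1 - (‖band T' (coef (g₃ ∘ shearMap i j P))‖ ^ 2 + ‖band T' (coef (gT ∘ shearMap i j P))‖ ^ 2) := by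
    have h := PF.norm_sq_band_compl_Front extra (m + 1)
    rw [hsucc, hdec, band_add, norm_sq_add_of_disjoint hdisj] at h
    linarith
  -- the complement part costs at most `1 - β m`
  have hT : ‖band T' (coef (gT ∘ shearMap i j P))‖ ^ 2 ≤ 1 - PF.β extra m := by
    have h1 := norm_band_le T' (coef (gT ∘ shearMap i j P))
    rw [norm_coef_comp_shearMap hgTs hij P, ← band_coef hθ, ← hcfm] at h1
    have h2 := PF.norm_sq_band_compl_Front extra m
    rw [← hFr] at h2
    nlinarith [norm_nonneg (band T' (coef (gT ∘ shearMap i j P))), norm_nonneg (band Frᶜ (PF.cf extra m))]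
  -- the old front's part: good modes `G` and the rest
  set G : Set Mode := {k | k ∈ Fr ∧ k i ∉ PF.Nbad extra m ∧ |k j| < K'} with hG
  set gG := modePiece G g₃ with hgG
  set gG' := modePiece Gᶜ g₃ with hgG'
  have hgGs : IsSmooth gG := isSmooth_modePiece hg₃s _
  have hgG's : IsSmooth gG' := isSmooth_modePiece hg₃s _
  have hdec₃ : coef (g₃ ∘ shearMap i j P) = coef (gG ∘ shearMap i j P) + coef (gG' ∘ shearMap i j P) :=
    coef_comp_eq_add_modePiece hg₃s i j P G
  -- (a) the rest is small already before the stage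
  have hcoef_gG' : coef gG' = band (Gᶜ ∩ Fr) (coef θ) := by
    rw [← band_coef hg₃s, hg₃, ← band_coef hθ, band_band]
  have hsub' : Gᶜ ∩ Fr ⊆ {k : Mode | k i ∈ PF.Nbad extra m} ∪ tailSet j K' := by
    intro k hk
    simp only [Set.mem_inter_iff, Set.mem_compl_iff, hG, Set.mem_setOf_eq, not_and, not_lt] at hk
    by_cases hb : k i ∈ PF.Nbad extra m
    · exact Or.inl hb
    · exact Or.inr (by rw [mem_tailSet]; exact hk.1 hk.2 hb)
  have ha : ‖coef (gG' ∘ shearMap i j P)‖ ≤ 1 / 2 ^ (m + 4) + 1 / 2 ^ (m + 5) := by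
    rw [norm_coef_comp_shearMap hgG's hij P, hcoef_gG']
    refine (norm_band_mono hsub' _).trans ((norm_band_union_le _ _ _).trans (add_le_add ?_ ?_))
    · exact PF.norm_band_Nbad_le extra hm
    · rw [norm_sqrt_tailSq, show m + 5 = m + 1 + 4 by ring, ← sqrt_tol]
      refine Real.sqrt_le_sqrt ?_
      have h := PF.tailSq_Kseq_le extra (m + 1)
      rwa [Nat.add_sub_cancel] at h
  -- (b) the good modes read small multipliers
  have hband_gG : ∀ k : Mode, (Fm1 : ℤ) ≤ 2 * |k j| → coef gG k = 0 := by
    intro k hk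
    rw [coef_apply hgGs.continuous, mFourierCoeff_modePiece hg₃s]
    refine Set.indicator_of_notMem (fun hkG => ?_) _
    simp only [hG, Set.mem_setOf_eq] at hkG
    have := hkG.2.2
    omega
  have hb : ‖band T' (coef (gG ∘ shearMap i j P))‖ ≤ 1 / 2 ^ (m + 4) := by
    have hpt : ∀ k ∈ T', ‖coef (gG ∘ shearMap i j P) k‖ ≤ 1 / 2 ^ (m + 4) * ‖coef gG k‖ := by
      intro k hk
      rw [hT'_mem] at hk
      rw [coef_comp_eq_mul_of_band hgGs hij (PF.one_le_F extra (m + 1)) (PF.stP_add_inv extra (m + 1)) hband_gG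
        (by rw [← hFm1_def]; omega), norm_mul]
      by_cases h0 : coef gG k = 0
      · simp [h0]
      · refine mul_le_mul_of_nonneg_right ?_ (norm_nonneg _)
        -- `k ∈ G`
        have hkG : k ∈ G := by
          by_contra hkG
          exact h0 (by rw [coef_apply hgGs.continuous, mFourierCoeff_modePiece hg₃s, Set.indicator_of_notMem hkG])
        simp only [hG, Set.mem_setOf_eq] at hkG
        have hfront : (Fm : ℤ) ≤ 4 * |k i| := hkG.1
        exact PF.norm_multiplier_front_le extra hm hfront hkG.2.1
    refine (norm_band_le_of_pointwise (by positivity) hpt).trans ?_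
    have : ‖band T' (coef gG)‖ ≤ 1 := by
      refine (norm_band_le _ _).trans ?_
      rw [← band_coef hg₃s, hg₃, ← band_coef hθ, band_band, ← hcfm]
      exact (norm_band_le _ _).trans (PF.norm_cf extra m).le
    calc 1 / 2 ^ (m + 4) * ‖band T' (coef gG)‖ ≤ 1 / 2 ^ (m + 4) * 1 := by gcongr
      _ = 1 / 2 ^ (m + 4) := mul_one _
  -- the old front's part after the stage, seen in `T'`
  have h3 : ‖band T' (coef (g₃ ∘ shearMap i j P))‖ ≤ 3 / 2 ^ (m + 4) := by
    rw [hdec₃, band_add]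
    refine (norm_add_le _ _).trans ?_
    refine (add_le_add hb ((norm_band_le _ _).trans ha)).trans ?_
    rw [show (3 : ℝ) / 2 ^ (m + 4) = 1 / 2 ^ (m + 4) + (1 / 2 ^ (m + 4) + 1 / 2 ^ (m + 4)) by ring]
    gcongr
    · norm_num
    · omega
  -- conclude
  have h3sq : ‖band T' (coef (g₃ ∘ shearMap i j P))‖ ^ 2 ≤ 9 / 4 ^ (m + 4) := by
    have := pow_le_pow_left₀ (norm_nonneg _) h3 2
    rw [div_pow, show ((2 : ℝ) ^ (m + 4)) ^ 2 = 4 ^ (m + 4) by rw [← pow_mul, mul_comm, pow_mul]; norm_num] at this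
    norm_num at this
    exact this
  rw [hβ1]
  linarith

end ProfileFamily

/-! ## The front at the first stage and the energy bookkeeping -/

namespace ProfileFamily

variable (PF : ProfileFamily) (extra : ℕ → (ℕ → ℕ) → ℕ)

/-- **The first stage almost empties the datum modes**: `β 1 ≥ 1 - 4^{-5}` (the datum reads the
multipliers `ĝ_{±1}(0)` at the exact half-integer phases `±1/2`, of size `≤ res 1 ≤ 2^{-5}`). [folklore] -/
theorem β_one_ge : 1 - 1 / 4 ^ 5 ≤ PF.β extra 1 := by
  set i : Fin 2 := dir 1 with hi
  set j : Fin 2 := dir 2 with hj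
  have hij : i ≠ j := (dir_succ_ne 1).symm
  set P := PF.stP extra 1 with hP_def
  have hθ : IsSmooth (fun x : 𝕋² => (rhoIn x : ℂ)) := PF.isSmooth_Θc extra 0
  have hsucc : PF.cf extra 1 = coef ((fun x : 𝕋² => (rhoIn x : ℂ)) ∘ shearMap i j P) := by
    rw [cf_eq, show (1 : ℕ) = 0 + 1 from rfl, PF.Θc_succ extra 0]; rfl
  set T' : Set Mode := (PF.Front extra 1)ᶜ with hT'
  have hT'_mem : ∀ k : Mode, k ∈ T' ↔ 4 * |k j| < PF.F extra 1 := fun k => by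
    simp [hT', Front, hj, not_le]
  have hk₀j : k₀ j = 0 := by
    simp only [k₀, hj]
    exact Pi.single_eq_of_ne (dir_succ_ne 1) _
  have hk₀i : k₀ i = 1 := by simp [k₀, hi]
  have hcoefρ : ∀ k : Mode, coef (fun x : 𝕋² => (rhoIn x : ℂ)) k ≠ 0 → k = k₀ ∨ k = -k₀ := by
    intro k hk
    rw [coef_apply continuous_rhoIn_complex, mFourierCoeff_rhoIn] at hk
    by_contra h
    push Not at h
    rw [if_neg h.1, if_neg h.2] at hk
    exact hk rfl
  have hband : ∀ k : Mode, (PF.F extra 1 : ℤ) ≤ 2 * |k j| → coef (fun x : 𝕋² => (rhoIn x : ℂ)) k = 0 := by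
    intro k hk
    by_contra h
    have hF := PF.one_le_F extra 1
    rcases hcoefρ k h with rfl | rfl
    · rw [hk₀j] at hk; simp at hk; omega
    · rw [Pi.neg_apply, hk₀j] at hk; simp at hk; omega
  -- the multipliers at `±1`
  have hmult : ∀ n : ℤ, (n = 1 ∨ n = -1) → ‖fourierCoeff (twist P n) 0‖ ≤ 1 / 2 ^ 5 := by
    intro n hn
    obtain ⟨l, hl, rfl⟩ : ∃ l : ℤ, l ≠ 0 ∧ n = 0 + l * PF.F extra (1 - 1) := by
      rcases hn with rfl | rfl
      · exact ⟨1, one_ne_zero, by simp [PF.F_zero]⟩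
      · exact ⟨-1, by norm_num, by simp [PF.F_zero]⟩
    refine (PF.norm_fourierCoeff_twist_stP_le extra 1 hl (by simp)).trans ?_
    simp only [Int.cast_zero, abs_zero, zero_mul, mul_zero, zero_add]
    exact PF.res_le 1
  have hpt : ∀ k ∈ T', ‖coef ((fun x : 𝕋² => (rhoIn x : ℂ)) ∘ shearMap i j P) k‖ ≤
      1 / 2 ^ 5 * ‖coef (fun x : 𝕋² => (rhoIn x : ℂ)) k‖ := by
    intro k hk
    rw [hT'_mem] at hk
    rw [coef_comp_eq_mul_of_band hθ hij (PF.one_le_F extra 1) (PF.stP_add_inv extra 1) hband (by omega), norm_mul]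
    by_cases h0 : coef (fun x : 𝕋² => (rhoIn x : ℂ)) k = 0
    · simp [h0]
    · refine mul_le_mul_of_nonneg_right (hmult (k i) ?_) (norm_nonneg _)
      rcases hcoefρ k h0 with rfl | rfl
      · exact Or.inl hk₀i
      · right; rw [Pi.neg_apply, hk₀i]
  have hbandT' : ‖band T' (PF.cf extra 1)‖ ≤ 1 / 2 ^ 5 := by
    rw [hsucc]
    refine (norm_band_le_of_pointwise (by positivity) hpt).trans ?_
    have : ‖band T' (coef (fun x : 𝕋² => (rhoIn x : ℂ)))‖ ≤ 1 :=
      (norm_band_le _ _).trans (PF.norm_cf extra 0).le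
    calc 1 / 2 ^ 5 * ‖band T' (coef fun x : 𝕋² => (rhoIn x : ℂ))‖ ≤ 1 / 2 ^ 5 * 1 := by gcongr
      _ = 1 / 2 ^ 5 := mul_one _
  have h := PF.norm_sq_band_compl_Front extra 1
  rw [← hT'] at h
  have hsq : ‖band T' (PF.cf extra 1)‖ ^ 2 ≤ (1 / 2 ^ 5) ^ 2 := pow_le_pow_left₀ (norm_nonneg _) hbandT' 2
  norm_num at hsq ⊢
  linarith

/-- **The front keeps at least `1011/1024` of the energy**: explicit lower bound for `β m`,
`m ≥ 1`, by telescoping `β_succ_ge` from `β_one_ge`. [folklore] -/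
theorem β_ge {m : ℕ} (hm : 1 ≤ m) : 1 - 13 / 1024 + 12 / (1024 * 4 ^ (m - 1)) ≤ PF.β extra m := by
  induction m, hm using Nat.le_induction with
  | base => have := PF.β_one_ge extra; norm_num at this ⊢; linarith
  | succ n hn ih =>
    have h := PF.β_succ_ge extra hn
    rw [Nat.add_sub_cancel]
    obtain ⟨k, rfl⟩ := Nat.exists_eq_add_of_le' hn
    rw [Nat.add_sub_cancel] at ih
    have e : (12 : ℝ) / (1024 * 4 ^ (k + 1)) = 12 / (1024 * 4 ^ k) - 9 / 4 ^ (k + 1 + 4) := by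
      field_simp; ring
    rw [e]; linarith

/-- `β m ≥ 63/64` for `m ≥ 1`. [folklore] -/
theorem β_ge' {m : ℕ} (hm : 1 ≤ m) : 63 / 64 ≤ PF.β extra m := by
  have h := PF.β_ge extra hm
  have : (0 : ℝ) ≤ 12 / (1024 * 4 ^ (m - 1)) := by positivity
  linarith

/-- `Low m` lies in the complement of the front. [folklore] -/
theorem Low_subset_compl_Front (m : ℕ) : PF.Low extra m ⊆ (PF.Front extra m)ᶜ := by
  intro k hk hk'
  have := hk (dir (m + 1))
  simp only [Front, Set.mem_setOf_eq] at hk'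
  omega

/-- **The low modes carry at most `1/8` of the norm**: `‖P_{Low m} cf m‖ ≤ 1/8` for `m ≥ 1`. [folklore] -/
theorem norm_band_Low_le {m : ℕ} (hm : 1 ≤ m) : ‖band (PF.Low extra m) (PF.cf extra m)‖ ≤ 1 / 8 := by
  refine (norm_band_mono (PF.Low_subset_compl_Front extra m) _).trans ?_
  have h := PF.norm_sq_band_compl_Front extra m
  have hβ := PF.β_ge' extra hm
  have h0 := norm_nonneg (band (PF.Front extra m)ᶜ (PF.cf extra m))
  nlinarith

/-- The frequencies are monotone. [folklore] -/
theorem F_mono : Monotone (PF.F extra) := by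
  refine monotone_nat_of_le_succ fun n => ?_
  have h := PF.eight_mul_F_le extra (by omega : 1 ≤ n + 1)
  rw [Nat.add_sub_cancel] at h
  omega

/-- The low boxes are nested. [folklore] -/
theorem Low_mono {m m' : ℕ} (h : m ≤ m') : PF.Low extra m ⊆ PF.Low extra m' := by
  intro k hk l
  have := hk l
  have hF : (PF.F extra m : ℤ) ≤ PF.F extra m' := by exact_mod_cast PF.F_mono extra h
  omega

end ProfileFamily

/-! ## The strong low-frequency limit `R` -/

namespace ProfileFamily

variable (PF : ProfileFamily) (extra : ℕ → (ℕ → ℕ) → ℕ)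

/-- Band projections are `1`-Lipschitz, hence continuous. [folklore] -/
theorem _root_.Literature.Analysis.FluidPDE.ShearCascade.continuous_band (A : Set Mode) : Continuous (band A) := by
  refine LipschitzWith.continuous (K := 1) (LipschitzWith.of_dist_le_mul fun f g => ?_)
  rw [NNReal.coe_one, one_mul, dist_eq_norm, dist_eq_norm, ← band_sub]
  exact norm_band_le _ _

/-- The low part of the later states seen from level `m`: `u_m(n) = P_{Low m} cf (m+n)`. [folklore] -/
def lowSeq (m n : ℕ) : El2 := band (PF.Low extra m) (PF.cf extra (m + n))

/-- **Geometric Cauchy bound**: `dist (u_m n) (u_m (n+1)) ≤ (3 · 2^{-(m+4)}) 2^{-n}` for `m ≥ 1`. [folklore] -/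
theorem dist_lowSeq_le {m : ℕ} (hm : 1 ≤ m) (n : ℕ) :
    dist (PF.lowSeq extra m n) (PF.lowSeq extra m (n + 1)) ≤ 3 / 2 ^ (m + 4) * (1 / 2) ^ n := by
  rw [dist_comm, dist_eq_norm, lowSeq, lowSeq, ← band_sub, show m + (n + 1) = m + n + 1 by ring]
  refine (norm_band_mono (PF.Low_mono extra (Nat.le_add_right m n)) _).trans ?_
  refine (PF.norm_band_Low_sub_le extra (by omega)).trans (le_of_eq ?_)
  rw [pow_add, one_div, inv_pow]; field_simp; ring

/-- `u_m` is Cauchy (`m ≥ 1`). [folklore] -/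
theorem cauchySeq_lowSeq {m : ℕ} (hm : 1 ≤ m) : CauchySeq (PF.lowSeq extra m) :=
  cauchySeq_of_le_geometric (1 / 2) (3 / 2 ^ (m + 4)) (by norm_num) (PF.dist_lowSeq_le extra hm)

/-- **The level-`m` limit** `R_m = lim_n P_{Low m} cf (m+n)`. [folklore] -/
def Rlevel (m : ℕ) : El2 := limUnder atTop (PF.lowSeq extra m)

/-- `u_m → R_m` (`m ≥ 1`). [folklore] -/
theorem tendsto_lowSeq {m : ℕ} (hm : 1 ≤ m) : Tendsto (PF.lowSeq extra m) atTop (𝓝 (PF.Rlevel extra m)) :=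
  (PF.cauchySeq_lowSeq extra hm).tendsto_limUnder

/-- **Distance from the level-`m` limit**: `‖P_{Low m} cf m - R_m‖ ≤ 3 · 2^{-(m+3)}`. [folklore] -/
theorem norm_band_Low_sub_Rlevel_le {m : ℕ} (hm : 1 ≤ m) :
    ‖band (PF.Low extra m) (PF.cf extra m) - PF.Rlevel extra m‖ ≤ 3 / 2 ^ (m + 3) := by
  have h := dist_le_of_le_geometric_of_tendsto₀ (1 / 2) (3 / 2 ^ (m + 4)) (by norm_num)
    (PF.dist_lowSeq_le extra hm) (PF.tendsto_lowSeq extra hm)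
  rw [dist_eq_norm, lowSeq, add_zero] at h
  refine h.trans (le_of_eq ?_)
  rw [pow_succ]; ring

/-- **Consistency of the levels**: `P_{Low m} R_{m'} = R_m` for `1 ≤ m ≤ m'`. [folklore] -/
theorem band_Low_Rlevel {m m' : ℕ} (hm : 1 ≤ m) (h : m ≤ m') :
    band (PF.Low extra m) (PF.Rlevel extra m') = PF.Rlevel extra m := by
  obtain ⟨d, rfl⟩ := Nat.exists_eq_add_of_le h
  -- `band Low_m ∘ u_{m+d} = u_m (· + d)`
  have h1 : Tendsto (fun n => band (PF.Low extra m) (PF.lowSeq extra (m + d) n)) atTop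
      (𝓝 (band (PF.Low extra m) (PF.Rlevel extra (m + d)))) :=
    ((continuous_band _).tendsto _).comp (PF.tendsto_lowSeq extra (by omega))
  have h2 : Tendsto (fun n => PF.lowSeq extra m (n + d)) atTop (𝓝 (PF.Rlevel extra m)) :=
    (PF.tendsto_lowSeq extra hm).comp (tendsto_add_atTop_nat d)
  have heq : (fun n => band (PF.Low extra m) (PF.lowSeq extra (m + d) n)) = fun n => PF.lowSeq extra m (n + d) := by
    funext n
    rw [lowSeq, lowSeq, band_band, Set.inter_eq_left.2 (PF.Low_mono extra (Nat.le_add_right m d)),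
      show m + d + n = m + (n + d) by ring]
  rw [heq] at h1
  exact tendsto_nhds_unique h1 h2

/-- `‖R_m‖ ≤ 1/8 + 3 · 2^{-(m+3)}` (`m ≥ 1`). [folklore] -/
theorem norm_Rlevel_le {m : ℕ} (hm : 1 ≤ m) : ‖PF.Rlevel extra m‖ ≤ 1 / 8 + 3 / 2 ^ (m + 3) := by
  have h1 := PF.norm_band_Low_sub_Rlevel_le extra hm
  have h2 := PF.norm_band_Low_le extra hm
  have h3 : ‖PF.Rlevel extra m‖ ≤ ‖band (PF.Low extra m) (PF.cf extra m)‖ +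
      ‖band (PF.Low extra m) (PF.cf extra m) - PF.Rlevel extra m‖ := by
    have := norm_sub_le (band (PF.Low extra m) (PF.cf extra m)) (band (PF.Low extra m) (PF.cf extra m) - PF.Rlevel extra m)
    rwa [sub_sub_cancel] at this
  linarith

end ProfileFamily

namespace ProfileFamily

variable (PF : ProfileFamily) (extra : ℕ → (ℕ → ℕ) → ℕ)

/-- `P_{Aᶜ} f = f - P_A f`. [folklore] -/
theorem _root_.Literature.Analysis.FluidPDE.ShearCascade.band_compl_eq_sub (A : Set Mode) (f : El2) :
    band Aᶜ f = f - band A f := by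
  apply lp.ext; funext k
  simp only [lp.coeFn_sub, Pi.sub_apply, band_apply]
  by_cases hk : k ∈ A <;> simp [hk]

/-- The levels, indexed from `1`: `Rs n = R_{n+1}`. [folklore] -/
def Rs (n : ℕ) : El2 := PF.Rlevel extra (n + 1)

/-- **Pythagoras between levels**: `‖Rs n' - Rs n‖² = ‖Rs n'‖² - ‖Rs n‖²` for `n ≤ n'`. [folklore] -/
theorem norm_sq_Rs_sub {n n' : ℕ} (h : n ≤ n') : ‖PF.Rs extra n' - PF.Rs extra n‖ ^ 2 = ‖PF.Rs extra n'‖ ^ 2 - ‖PF.Rs extra n‖ ^ 2 := by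
  have hc := PF.band_Low_Rlevel extra (by omega : 1 ≤ n + 1) (by omega : n + 1 ≤ n' + 1)
  have hp := norm_sq_band_add_compl (PF.Low extra (n + 1)) (PF.Rlevel extra (n' + 1))
  rw [band_compl_eq_sub, hc] at hp
  unfold Rs; linarith

/-- The level norms are monotone. [folklore] -/
theorem norm_Rs_mono : Monotone fun n => ‖PF.Rs extra n‖ := by
  intro n n' h
  have hc := PF.band_Low_Rlevel extra (by omega : 1 ≤ n + 1) (by omega : n + 1 ≤ n' + 1)
  simp only [Rs]
  rw [← hc]
  exact norm_band_le _ _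

/-- The level norms are bounded by `1/2`. [folklore] -/
theorem norm_Rs_le (n : ℕ) : ‖PF.Rs extra n‖ ≤ 1 / 2 := by
  refine (PF.norm_Rlevel_le extra (by omega : 1 ≤ n + 1)).trans ?_
  have : (3 : ℝ) / 2 ^ (n + 1 + 3) ≤ 3 / 2 ^ 4 := by
    gcongr
    · norm_num
    · omega
  norm_num at this ⊢
  linarith

/-- **The levels form a Cauchy sequence** (monotone bounded norms and Pythagoras). [folklore] -/
theorem cauchySeq_Rs : CauchySeq (PF.Rs extra) := by
  set a : ℕ → ℝ := fun n => ‖PF.Rs extra n‖ ^ 2 with ha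
  have hmono : Monotone a := fun n n' h => by
    simp only [ha]
    exact pow_le_pow_left₀ (norm_nonneg _) (PF.norm_Rs_mono extra h) 2
  have hbdd : BddAbove (Set.range a) := ⟨1, by
    rintro _ ⟨n, rfl⟩
    simp only [ha]
    have := PF.norm_Rs_le extra n
    nlinarith [norm_nonneg (PF.Rs extra n)]⟩
  have hconv := tendsto_atTop_ciSup hmono hbdd
  set L := ⨆ n, a n
  rw [Metric.cauchySeq_iff']
  intro ε hε
  have hε2 : 0 < ε ^ 2 := by positivity
  obtain ⟨N, hN⟩ := (Metric.tendsto_atTop.1 hconv) (ε ^ 2) hε2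
  refine ⟨N, fun n hn => ?_⟩
  have h1 := hN n hn
  have h2 := hN N le_rfl
  rw [Real.dist_eq] at h1 h2
  have hle : a n ≤ L := le_ciSup hbdd n
  have hsq := PF.norm_sq_Rs_sub extra hn
  have hlt : ‖PF.Rs extra n - PF.Rs extra N‖ ^ 2 < ε ^ 2 := by
    rw [hsq]
    have := (abs_lt.1 h2).1
    simp only [ha] at hle ⊢
    linarith
  rw [dist_eq_norm]
  exact pow_lt_pow_iff_left₀ (norm_nonneg _) hε.le two_ne_zero |>.1 hlt

/-- **The strong low-frequency limit `R`** of the cascade (in `ℓ²`). [folklore] -/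
def R : El2 := limUnder atTop (PF.Rs extra)

/-- `Rs → R`. [folklore] -/
theorem tendsto_Rs : Tendsto (PF.Rs extra) atTop (𝓝 (PF.R extra)) :=
  (PF.cauchySeq_Rs extra).tendsto_limUnder

/-- **`‖R‖ ≤ 1/8`.** [folklore] -/
theorem norm_R_le : ‖PF.R extra‖ ≤ 1 / 8 := by
  have h1 : Tendsto (fun n => ‖PF.Rs extra n‖) atTop (𝓝 ‖PF.R extra‖) :=
    (continuous_norm.tendsto _).comp (PF.tendsto_Rs extra)
  have h2 : Tendsto (fun n : ℕ => (1 : ℝ) / 8 + 3 / 2 ^ (n + 1 + 3)) atTop (𝓝 (1 / 8 + 0)) := by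
    refine tendsto_const_nhds.add ?_
    have h : Tendsto (fun n : ℕ => (3 : ℝ) * (1 / 2) ^ n * (1 / 2 ^ 4)) atTop (𝓝 (3 * 0 * (1 / 2 ^ 4))) :=
      ((tendsto_pow_atTop_nhds_zero_of_lt_one (by norm_num) (by norm_num)).const_mul 3).mul_const _
    rw [mul_zero, zero_mul] at h
    refine h.congr fun n => ?_
    rw [pow_add, pow_add, one_div, inv_pow]; field_simp
  rw [add_zero] at h2
  exact le_of_tendsto_of_tendsto' h1 h2 fun n => PF.norm_Rlevel_le extra (by omega)

/-- **Strong convergence of the low modes**: `‖P_{Low m} cf m - R‖ → 0`. [folklore] -/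
theorem tendsto_norm_band_Low_sub_R :
    Tendsto (fun m => ‖band (PF.Low extra m) (PF.cf extra m) - PF.R extra‖) atTop (𝓝 0) := by
  -- along `m = n + 1`
  have h1 : Tendsto (fun n => ‖PF.Rs extra n - PF.R extra‖) atTop (𝓝 0) := by
    have := (PF.tendsto_Rs extra).sub_const (PF.R extra)
    rw [sub_self] at this
    have h := (continuous_norm.tendsto (0 : El2)).comp this
    rw [norm_zero] at h
    exact h
  have h2 : Tendsto (fun n : ℕ => (3 : ℝ) / 2 ^ (n + 1 + 3)) atTop (𝓝 0) := by
    have h : Tendsto (fun n : ℕ => (3 : ℝ) * (1 / 2) ^ n * (1 / 2 ^ 4)) atTop (𝓝 (3 * 0 * (1 / 2 ^ 4))) :=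
      ((tendsto_pow_atTop_nhds_zero_of_lt_one (by norm_num) (by norm_num)).const_mul 3).mul_const _
    rw [mul_zero, zero_mul] at h
    refine h.congr fun n => ?_
    rw [pow_add, pow_add, one_div, inv_pow]; field_simp
  have h3 : Tendsto (fun n => ‖band (PF.Low extra (n + 1)) (PF.cf extra (n + 1)) - PF.R extra‖) atTop (𝓝 0) := by
    have hsum := h2.add h1
    rw [add_zero] at hsum
    refine tendsto_of_tendsto_of_tendsto_of_le_of_le' tendsto_const_nhds hsum
      (Eventually.of_forall fun n => norm_nonneg _) (Eventually.of_forall fun n => ?_)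
    calc ‖band (PF.Low extra (n + 1)) (PF.cf extra (n + 1)) - PF.R extra‖
        ≤ ‖band (PF.Low extra (n + 1)) (PF.cf extra (n + 1)) - PF.Rlevel extra (n + 1)‖ + ‖PF.Rlevel extra (n + 1) - PF.R extra‖ :=
          norm_sub_le_norm_sub_add_norm_sub _ _ _
      _ ≤ 3 / 2 ^ (n + 1 + 3) + ‖PF.Rs extra n - PF.R extra‖ :=
          add_le_add (PF.norm_band_Low_sub_Rlevel_le extra (by omega)) le_rfl
  exact (tendsto_add_atTop_iff_nat 1).1 h3

end ProfileFamily

/-! ## Hermitian symmetry and the real limit function -/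

section Hermitian

/-- A coefficient family is Hermitian if `f(-k) = conj f(k)` (the symmetry of the coefficients of
real functions). [folklore] -/
def IsHermitian (f : El2) : Prop := ∀ k : Mode, f (-k) = conj (f k)

/-- **Coefficients of real functions are Hermitian.** [folklore] -/
theorem mFourierCoeff_neg_of_real {g : 𝕋² → ℝ} (k : Mode) :
    mFourierCoeff (fun x => (g x : ℂ)) (-k) = conj (mFourierCoeff (fun x => (g x : ℂ)) k) := by
  rw [mFourierCoeff_eq_integral_volume, mFourierCoeff_eq_integral_volume, ← integral_conj]
  refine integral_congr_ae (Eventually.of_forall fun x => ?_)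
  simp only [neg_neg, smul_eq_mul, map_mul, Complex.conj_ofReal, mFourier_neg, RingHomCompTriple.comp_apply,
    RingHom.id_apply]

/-- `coef` of a complexified real continuous function is Hermitian. [folklore] -/
theorem isHermitian_coef_real {g : 𝕋² → ℝ} (hg : Continuous g) : IsHermitian (coef fun x => (g x : ℂ)) := by
  intro k
  have hc : Continuous fun x => (g x : ℂ) := Complex.continuous_ofReal.comp hg
  rw [coef_apply hc, coef_apply hc, mFourierCoeff_neg_of_real]

/-- Bands symmetric under `k ↦ -k` preserve Hermitian symmetry. [folklore] -/
theorem IsHermitian.band {f : El2} (hf : IsHermitian f) {A : Set Mode} (hA : ∀ k, k ∈ A ↔ -k ∈ A) :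
    IsHermitian (band A f) := by
  intro k
  simp only [band_apply]
  by_cases hk : k ∈ A
  · rw [Set.indicator_of_mem ((hA k).1 hk), Set.indicator_of_mem hk, hf k]
  · rw [Set.indicator_of_notMem (fun h => hk ((hA k).2 h)), Set.indicator_of_notMem hk, map_zero]

/-- Evaluation at a mode is continuous on `ℓ²`. [folklore] -/
theorem continuous_apply_el2 (k : Mode) : Continuous fun f : El2 => f k := by
  refine LipschitzWith.continuous (K := 1) (LipschitzWith.of_dist_le_mul fun f g => ?_)
  rw [NNReal.coe_one, one_mul, dist_eq_norm, dist_eq_norm, ← Pi.sub_apply, ← lp.coeFn_sub]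
  exact norm_apply_le_norm _ _

/-- **Limits of Hermitian families are Hermitian.** [folklore] -/
theorem IsHermitian.of_tendsto {u : ℕ → El2} {a : El2} (hu : ∀ n, IsHermitian (u n)) (ha : Tendsto u atTop (𝓝 a)) :
    IsHermitian a := by
  intro k
  have h1 : Tendsto (fun n => u n (-k)) atTop (𝓝 (a (-k))) := ((continuous_apply_el2 (-k)).tendsto a).comp ha
  have h2 : Tendsto (fun n => conj (u n k)) atTop (𝓝 (conj (a k))) :=
    (Complex.continuous_conj.tendsto _).comp (((continuous_apply_el2 k).tendsto a).comp ha)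
  have heq : (fun n => u n (-k)) = fun n => conj (u n k) := funext fun n => hu n k
  rw [heq] at h1
  exact tendsto_nhds_unique h1 h2

end Hermitian

namespace ProfileFamily

variable (PF : ProfileFamily) (extra : ℕ → (ℕ → ℕ) → ℕ)

/-- `Low m` is symmetric under `k ↦ -k`. [folklore] -/
theorem neg_mem_Low_iff (m : ℕ) (k : Mode) : k ∈ PF.Low extra m ↔ -k ∈ PF.Low extra m := by
  simp [Low]

/-- `cf s` is Hermitian. [folklore] -/
theorem isHermitian_cf (s : ℕ) : IsHermitian (PF.cf extra s) :=
  isHermitian_coef_real (PF.isSmooth_Theta _ s).continuous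

/-- The levels `R_m` are Hermitian (`m ≥ 1`). [folklore] -/
theorem isHermitian_Rlevel {m : ℕ} (hm : 1 ≤ m) : IsHermitian (PF.Rlevel extra m) :=
  IsHermitian.of_tendsto (fun n => (PF.isHermitian_cf extra (m + n)).band (PF.neg_mem_Low_iff extra m))
    (PF.tendsto_lowSeq extra hm)

/-- **`R` is Hermitian.** [folklore] -/
theorem isHermitian_R : IsHermitian (PF.R extra) :=
  IsHermitian.of_tendsto (fun n => PF.isHermitian_Rlevel extra (by omega)) (PF.tendsto_Rs extra)

/-- Mathlib's volume on `T²` (the one the Fourier basis `UnitAddTorus.mFourierBasis` lives in). [folklore] -/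
def mathlibVolume : Measure 𝕋² :=
  @volume 𝕋² (@MeasureSpace.pi (Fin 2) _ (fun _ => UnitAddCircle) fun _ => instMeasureSpaceUnitAddCircle)

/-- Mathlib's volume on `T²` is the tree's. [folklore] -/
theorem mathlibVolume_eq : mathlibVolume = (volume : Measure 𝕋²) := by
  unfold mathlibVolume
  change (Measure.pi fun _ => @volume UnitAddCircle instMeasureSpaceUnitAddCircle) =
    Measure.pi fun _ => (volume : Measure UnitAddCircle)
  congr 1
  funext i
  exact volume_unitAddCircle_eq_haar.symm

/-- The `L²` function with coefficients `R` (Riesz–Fischer through Mathlib's Fourier basis). [folklore] -/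
def Rcx : 𝕋² → ℂ := ⇑((mFourierBasis (d := Fin 2)).repr.symm (PF.R extra))

/-- `Rcx ∈ L²(T²)`. [folklore] -/
theorem memLp_Rcx : MemLp (PF.Rcx extra) 2 volume := by
  have h : MemLp (PF.Rcx extra) 2 mathlibVolume := Lp.memLp _
  rwa [mathlibVolume_eq] at h

/-- **The coefficients of `Rcx` are `R`.** [folklore] -/
theorem mFourierCoeff_Rcx (k : Mode) : mFourierCoeff (PF.Rcx extra) k = PF.R extra k := by
  rw [Rcx, ← mFourierBasis_repr]
  simp

/-- **The real limit function** `R_fn = Re Rcx`. [folklore] -/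
def Rfn (x : 𝕋²) : ℝ := (PF.Rcx extra x).re

/-- `R_fn ∈ L²(T²)`. [folklore] -/
theorem memLp_Rfn : MemLp (PF.Rfn extra) 2 volume := (PF.memLp_Rcx extra).re

/-- `Rcx` is integrable. [folklore] -/
theorem integrable_Rcx : Integrable (PF.Rcx extra) volume := (PF.memLp_Rcx extra).integrable one_le_two

/-- Coefficients of a conjugate: `𝓕(conj G)(k) = conj 𝓕G(-k)`. [folklore] -/
theorem _root_.Literature.Analysis.FluidPDE.ShearCascade.mFourierCoeff_conj (G : 𝕋² → ℂ) (k : Mode) :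
    mFourierCoeff (fun x => conj (G x)) k = conj (mFourierCoeff G (-k)) := by
  rw [mFourierCoeff_eq_integral_volume, mFourierCoeff_eq_integral_volume, ← integral_conj]
  refine integral_congr_ae (Eventually.of_forall fun x => ?_)
  simp only [neg_neg, smul_eq_mul, map_mul, mFourier_neg]

/-- **The coefficients of the real limit function are `R`** (`R` is Hermitian, so taking the real
part of `Rcx` does not change the coefficients). [folklore] -/
theorem mFourierCoeff_Rfn (k : Mode) : mFourierCoeff (fun x => (PF.Rfn extra x : ℂ)) k = PF.R extra k := by
  have hG := PF.integrable_Rcx extra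
  have hGc : Integrable (fun x => conj (PF.Rcx extra x)) volume := by
    simpa using (Complex.conjLIE.toContinuousLinearEquiv.toContinuousLinearMap.integrable_comp hG)
  have hfun : (fun x => (PF.Rfn extra x : ℂ)) = (2⁻¹ : ℂ) • ((PF.Rcx extra) + fun x => conj (PF.Rcx extra x)) := by
    funext x
    simp only [Rfn, Pi.smul_apply, Pi.add_apply, smul_eq_mul, Complex.re_eq_add_conj]
    ring
  rw [hfun, mFourierCoeff_const_smul]
  have hadd : mFourierCoeff ((PF.Rcx extra) + fun x => conj (PF.Rcx extra x)) k =
      mFourierCoeff (PF.Rcx extra) k + mFourierCoeff (fun x => conj (PF.Rcx extra x)) k := by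
    have h := mFourierCoeff_sub (hG.add hGc) hGc k
    rw [add_sub_cancel_right] at h
    rw [eq_sub_iff_add_eq] at h
    exact h.symm
  rw [hadd, mFourierCoeff_conj, PF.mFourierCoeff_Rcx, PF.mFourierCoeff_Rcx, PF.isHermitian_R extra k,
    Complex.conj_conj, smul_eq_mul]
  ring

end ProfileFamily

/-! ## Exhaustion of the frequency lattice by the low boxes -/

namespace ProfileFamily

variable (PF : ProfileFamily) (extra : ℕ → (ℕ → ℕ) → ℕ)

/-- `8^m ≤ F_m`. [folklore] -/
theorem pow_le_F (m : ℕ) : 8 ^ m ≤ PF.F extra m := by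
  induction m with
  | zero => simp [PF.F_zero]
  | succ n ih =>
    have h := PF.eight_mul_F_le extra (by omega : 1 ≤ n + 1)
    rw [Nat.add_sub_cancel] at h
    calc 8 ^ (n + 1) = 8 * 8 ^ n := by ring
      _ ≤ 8 * PF.F extra n := Nat.mul_le_mul_left 8 ih
      _ ≤ PF.F extra (n + 1) := h

/-- `F_m → ∞`. [folklore] -/
theorem tendsto_F_atTop : Tendsto (PF.F extra) atTop atTop :=
  tendsto_atTop_mono (PF.pow_le_F extra) (tendsto_pow_atTop_atTop_of_one_lt (by norm_num))

/-- **Every mode is eventually low**: `k ∈ Low m` for all large `m`. [folklore] -/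
theorem eventually_mem_Low (k : Mode) : ∀ᶠ m in atTop, k ∈ PF.Low extra m := by
  have h := (PF.tendsto_F_atTop extra).eventually_gt_atTop (4 * (|k 0| + |k 1|)).toNat
  filter_upwards [h] with m hm
  intro l
  have hF : ((4 * (|k 0| + |k 1|)).toNat : ℤ) < PF.F extra m := by exact_mod_cast hm
  rw [Int.toNat_of_nonneg (by positivity)] at hF
  have h0 := abs_nonneg (k 0)
  have h1 := abs_nonneg (k 1)
  fin_cases l <;> simp <;> omega

end ProfileFamily

end ShearCascade

end Literature.Analysis.FluidPDE
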